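import Literature.MathematicalPhysics.QuantumFieldTheory.Balaban1983to89.B5G183CovDecay
import Literature.MathematicalPhysics.QuantumFieldTheory.Balaban1983to89.T4Rate166StripDirect
import Literature.MathematicalPhysics.QuantumFieldTheory.Balaban1983to89.T4Hk163StripRate

/-!
# `Balaban1983to89.T4G183StripRate` — the η-RATE of the fine-offset multipliers of the COVARIANT REGULAR PART of the continued (1.83) entry symbol of `G = Δ₁⁻¹` on the COMPLEX ZERO-FREE STRIP at the full rate `η¹`, and the exponentially-decaying η-rate of their lattice / torus kernels, uniformly in the volume (cell lane t4-ne2, seat P2 "strip/contour", generation 6; spine estimate NE2 (U1a), node X9; GAPS G-ne2p2-9 (β))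

HONEST FRAMING (page 1).  Rung (B)+1 bookkeeping for the LINEAR (Gaussian) theory on FINITE tori / the unit lattice
`ℤ^{d+1}`, gauge group U(1), background field switched OFF (`U = 1`), `a = 1`, general dimension.  This is NOT an
infinite-volume statement about the model, NOT a mass-gap statement, NOT a statement about the Clay problem and NOT
summit progress: it is a kernel certificate for ONE input of the cell's spine estimate NE2 — the rate, in the lattice
spacing `η = 1/n`, at which the fine-offset multipliers `M^{cov,N}_{ab;μν}{}^{(n)}` (`B5G183CovDecay.Mcov`) of the
COVARIANT REGULAR PART `g^{cov,N}` (`B5G183CovSplit.g183cov`) of the lineage's holomorphic continuation of the (1.83)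
entry symbol converge on the complex strip, and hence the rate of their position-space kernels WITH exponential decay,
uniformly in the periods.  Conditional on nothing: no `BetaPertH`, no hypothesis (B)/(B^μ) enters (the statements are
about explicit trigonometric rational functions); every declaration is `[folklore]` audit mathematics proved here from
tree modules BY NAME.  No `axiom`, no `sorry`.

SOURCES (locations of printed TEXT only; nothing printed is used as a hypothesis — ABSOLUTE RULE).
* T. Bałaban, *Propagators and renormalization transformations for lattice gauge theories. I*, Commun. Math. Phys. **95**
  (1984) 17–40 [`Balaban1984PropagatorsI`, cell paper B5; held text `paper:balaban1984-cmp95-propagators-rt-i`]: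
  (1.83)–(1.84) p. 31 [PDF 15] (the fiber-matrix entries of `G = Δ_a⁻¹`, typed verbatim by the lineage as
  `B5Prop11Bound.Fiber.G` and continued/regrouped on the strip as `B5G183Strip.g183`, see that file's header for the
  printed formula), the cancellation sentences p. 32 [PDF 16], and p. 38 [PDF 22, l. 9–11], the METHOD, verbatim: «They
  follow from the representation P = G′Q′*(Q′G′²Q′*)⁻¹Q′G′, from Lemma 2.4 of [2], and the representation (1.45) and the
  analyticity method of proving an exponential decay (see the proof of Lemma 2.4 in [2]).»  B5 prints NO display
  asserting an `η`-rate of the kernel of (1.83); what is proved below is an AUDIT CONSTRUCTION in the style of the p. 38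
  analyticity method, for the lineage's regular part only.
* C. King, *The U(1) Higgs model. I*, Commun. Math. Phys. **102** (1986) 649–677 [`King1986`], §4 pp. 672–673: the
  MECHANISM, verbatim p. 672: «To analyze the m = 0 term in (4.19), we successively replace each factor by the
  corresponding one in the expression for (∂_α(x, y)∂^η_μ a_kG^η_kQ^*_k)(z) and bound the error. We must always be careful
  to keep enough negative powers of momentum so that» [p. 673:] «the sum over l is bounded.» — implemented by the `RB`
  bookkeeping packages below, with ABSOLUTE rates on the complex strip and the alias PAIRING `ι` of
  `T4Rate166StripDirect` (gen 4).  King's text concerns the scalar `a_kG_kQ_k^*`; nothing in King concerns Bałaban's `G`.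

## The objects (all from the tree, imported by name)

Level `n` (fine lattice `ηℤ^d`, `η = 1/n`, over the unit lattice), complex fibre momentum `p′ ∈ Strip d κ`
(`|Im p′_ν| ≤ κ ≤ κ₁₈₃(d)`, the zero-free strip of `B5G183Strip` §6), aliases `l = 2πk`, `k ∈ (Fin n)^d`: the regrouped
continued entry symbol `g183 = δ_{μν}A(l,l′;μ) + midG·B₁(l,μ)·B₂(l′,ν)` (`B5G183Strip`; its factors `R^G`, `Y^G = Δ + Y`,
`F^G`, `𝒩`, `X_{≠0}`, `P(l,l′) = pairD`, the square brackets `B₁`, `B₂`, the leaves `v̄C`, `ūC`, `vC`, `uC`, `∂C`, `∂̄C`,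
`e^{±}`), the split `A = diagReg + δ_{ll′}(1−δ_{l0})/Δ(p′+l)` (`B5G183AliasSum`), the covariant split
`g = freeN N + g^{cov,N}`, `freeN = δδ·Σ_{j<N}(Δ(p′+l)+1)^{−(j+1)}` (`B5G183CovSplit`), the fine-offset phases `phase163`,
`phaseNeg` and the multiplier **`Mcov n N μ ν a b p′ = Σ_{l,l′} phase163(l,a)·g^{cov,N}_{μν}(l,l′)·phaseNeg(l′,b)`**
(`B5G183CovDecay`), the pairing `ι = iotaK n m` of level-`n` aliases with level-`m` aliases (`n ≤ m`) and the recentred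
shifted Laplacian `SW` (`T4Rate166StripDirect`), the alias weights `ω_n(j)`, `W_n(k) = Σ_ν ω_n(k_ν)²`, `wt`
(`B4StripSums`, `B5G183AliasSum`).  Fine offsets `a ∈ (Fin n)^d`, `a′ ∈ (Fin m)^d` are at the SAME PHYSICAL POSITION
when `a′_ν·n = a_ν·m` for all `ν` (hypotheses `ha`, `hb`; King's shape `m = nL^j`, `a′ = a·L^j`).

## What is proved (sorry-free; constants ours, crude, `d`- and `N`-only)

* §1 = the TOOLKIT of `T4Hk163StripRate` §1–§3 (gen 5 of this seat, v1.2), imported BY NAME (the explicit `open … (…)`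
  list below; nothing of it is restated here): the `wc`-leaves (`vCbar_iotaK_eq_gm`, `vCbar_RB`:
  `‖v̄C^{(m)}_μ(ιl) − v̄C^{(n)}_μ(l)‖ ≤ Cv/n`, bound `12/ω_n(l_μ)`; `dC_mul_vCbar_RB`), phase matching `phase163_iotaK_eq`,
  the profile `prof`, `sum_prof_le`, the UNPAIRED GAIN `inv_W_unpaired_le` (`W_m(K)⁻¹ ≤ (2/n)·W_m(K)^{−1/2}`), the `RB`
  normal forms and the packages of `SW⁻¹`, `ρ_l`, `T(l)`, `X_{≠0}` (`Xne_RB`), `𝒩` (`Ncal_RB`), `ūC` (`uCbar_RB`),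
  `Π_{ν≠μ}v̄C_ν` (`prodErase_RB`).
* §2 two summable alias profiles with the zero alias INCLUDED, `bw = Pom·wt` (bound currency) and `rw = Pom·tw⁻¹`
  (rate currency, `tw = √W` off zero, `1` at zero): `sum_rw_le`/`sum_bw_le` (`≤ Crw(d)` uniformly in the level),
  `bw_unpaired_le` (`bw_m(K) ≤ (2/n)·rw_m(K)` at an unpaired alias), monotonicity under the pairing (`rw_iotaK_le`);
  the conjugate leaves `vC`, `uC`, `∂̄C·vC` (`vC_RB`, `uC_RB`, `dCbar_mul_vC_RB`, by `RB_conj` from the §1 toolkit); the scalar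
  denominators of (1.83) on the zero-free strip: `RG_RB`, `YG_RB`, `YGinv_RB`, `Ninv_RB`, `FG_RB`, `midG_RB` (rate
  `n⁻²`), `SW1i_RB`, `D01i_RB` (and the imported `SWinv_RB`), `resolv_RB` (the resolvent sum `R_N`).
* §3 packages with alias decay: `pairD_RB` (bound `βP·wt(l)wt(l′)`, rate `κP·n⁻²·(wt(l)+wt(l′))`), `diagReg_ne_RB` /
  `diagReg_zero_RB` / `diagRegAll_RB` (the `δ_{μν}`-term), the square brackets through the inverse-form identities
  `B1_ne_eq`, `B1_zero_eq`, `B2_ne_eq`, `B2_zero_eq` and the generic bracket lemmas `bracketNe_RB`, `bracketZero_RB`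
  fed with the leaf packages resp. their conjugates: **`B1_RB`**, **`B2_RB`** (bound `βB1·bw(l)`, rate `κB1·n⁻¹·rw(l)`,
  EVERY alias), `midB_RB`, the diagonal correction `corr_RB` (`l ≠ 0`: `Δ(p′+l)⁻¹(Δ(p′+l)+1)^{−N}`, bound
  `(64/7)^{N+1}W^{−N−1}`; `l = 0`: `−R_N(Δ(p′))`), and **`gcov_RB`**: under the pairing,
  `‖g^{cov,N(m)}(ιl,ιl′) − g^{cov,N(n)}(l,l′)‖ ≤ κG·n⁻¹·rw(l)rw(l′) + δ_{μν}δ_{ll′}corrR(l)/n²`, with the level bound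
  `βG·bw(l)bw(l′) + δδ·corrB(l)`.
* §4 **`Mcov_rate`**: for `1 ≤ n ≤ m`, `0 ≤ κ ≤ κ₁₈₃(d)`, `N ≥ d`, `p′ ∈ Strip d κ`, every `μ, ν` and fine offsets at
  the same physical positions, `‖M^{(m)}_{a′b′}(p′) − M^{(n)}_{ab}(p′)‖ ≤ (e^κ)^d(e^κ)^d·C183(d,N)/n` (`sum_sum_split`:
  paired block by `gcov_RB` and `sum_rw_le`, `sum_corrR_le`; unpaired rest by the level bound, `bw_unpaired_le`,
  `corrB_unpaired_le`, `sum_corrU_le`; `n = 1` by `B5G183CovDecay.norm_Mcov_le`); `Mcov_rate_two` is the `n ≥ 2` core.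
* §5 position space on `ℂ^{d+1}` (`N ≥ d + 1`): `stripRegular_Mcov_sub` (the level difference is
  `B4ContourShift.StripRegular` on `Strip (d+1) κ` with bound THE RATE `C183e(d+1,N)/n`), hence BY NAME of the b04
  engines `latticeKernel_Mcov_rate` (`‖K^{(m)}_{a′b′}(x) − K^{(n)}_{ab}(x)‖ ≤ C183e(d+1,N)/n · e^{−κ₁₈₃(d+1)|x|_∞}` on
  `ℤ^{d+1}`; `B4ContourShift.latticeKernel_decay`, `B4Green242Bridge.latticeKernel_sub`) and `torusKernel_Mcov_rate`
  (every period vector, UNIFORMLY IN THE VOLUME: `≤ C183e(d+1,N)/n · periodConst · e^{−(κ₁₈₃(d+1)/(d+1))|x|_{T,∞}}`;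
  `B4TorusKernel.MultiPeriod.torusKernel_descend_decay_torusMetric`, `T4GaugeActionRateStrip.torusKernel_descendC_sub`),
  with King's shape `n = L^k`, `m = L^{k+j}` (amplitude `C183e·L^{−k}`).

## Relation to the sibling modules (delta)

`B5G183CovDecay` (pv15 lineage) proves the `n`-uniform strip bound and the kernel DECAY of `Mcov` with no rate;
`B5G183RateSum` / seat P1 prove RELATIVE rates `N^{−γ}`, `γ < 1`, at REAL fine-zone momenta without spatial decay;
`T4Hk163StripRate` (gen 5 of this seat) is the (1.63) analogue (`H_k`).  This module: the covariant regular part of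
(1.83) on the COMPLEX strip at the rate `η¹ = 1/n` (the `v̄`/`v`-leaves carry half-spacing phases whose own rate is
`O(η)`; no optimality is claimed), with the exponential decay `e^{−κ₁₈₃|x|}` and uniformity in the volume — the
combination the contour-shift engine of b04 delivers.  The rate is for `Mcov` (the regular part `g^{cov,N}`), NOT for
the full entry symbol `g183` (whose free part `freeN` is not `n`-uniformly rate-bounded in this currency).

## Honest scope

(i) As in `B5G183CovDecay`, what converges here is the COARSE-LATTICE kernel of the multiplier of the covariant
REGULAR PART, per pair of fine offsets and per `(μ, ν)`; the identification of the `Σ_{a,b}`-blocks with the kernel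
`G(1)(x,x′)` of (1.83) on the fine lattice (`B5Hk163Decay.exp_fine_phase_split` and its conjugate) and the re-addition of
the FREE part `δ_{μν}Σ_{j<N}(−Δ^η+1)^{−(j+1)}(x,x′)` (explicit powers of the massive free propagator, NOT typed in this
lineage) remain the consumer's bookkeeping (GAPS row G-ne2p2-9 (β), residual).  (ii) `U = 1`, `a = 1` throughout: the
background-field layer of (1.83)–(1.84) is not touched; general `U` has no momentum representation and is outside this
technique.  (iii) Constants (`C183`, `C183e`, `κG`, `βG`, …) are explicit but astronomically crude and depend on `d` and
the splitting order `N ≥ d` only — never Bałaban's `O(1)`; the width is the pv15 width `κ₁₈₃`.  (iv) This is NOT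
Bałaban's proof of Proposition 1.2 / (1.90) (he applies the analyticity method to `𝒟(p′)⁻¹` after the operator identity
(1.88)); it is the lineage's symbol-level route, recorded as such; no claim about print.  (v) Nothing here is a
statement about `a_k`, the effective actions, or any non-linear step.  Unit `b2b-balaban-t4-ne2-p2-g6`.
-/

namespace Literature.MathematicalPhysics.QuantumFieldTheory.Balaban1983to89.T4G183StripRate

open scoped BigOperators
open Finset Complex
open Literature.MathematicalPhysics.QuantumFieldTheory.Balaban1983to89.B4Strip
open Literature.MathematicalPhysics.QuantumFieldTheory.Balaban1983to89.B4StripCauchy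
open Literature.MathematicalPhysics.QuantumFieldTheory.Balaban1983to89.B4StripSums
  (w v omega omega_pos one_le_omega omega_zero omega_le_left omega_le_right W W_nonneg one_le_W omega_sq_le_W
    norm_v_le norm_sq_exp_sub_one Sxi_eq_sq_mul_S1 zetaC zetaC_nonneg sum_omega_rpow_le inv_W_le_prod_rpow)
open Literature.MathematicalPhysics.QuantumFieldTheory.Balaban1983to89.B5Symbol166
open Literature.MathematicalPhysics.QuantumFieldTheory.Balaban1983to89.B5Symbol166Strip
open Literature.MathematicalPhysics.QuantumFieldTheory.Balaban1983to89.B5Strip145 (Ncal Xne)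
open Literature.MathematicalPhysics.QuantumFieldTheory.Balaban1983to89.B5Hk163Strip
  (vC vCbar uCbar dC Tfac Afac headC tailC gdir h163 kappa163 kappa163_pos kappa163_le_rOf
    dC_mul_vCbar norm_dC_mul_vCbar_le norm_gdir_le Mg163 cY163 cN163 cF163 cY163_pos cN163_pos cF163_pos
    kappa163_le_kappaY Yc_lower norm_div_le_of)
open Literature.MathematicalPhysics.QuantumFieldTheory.Balaban1983to89.B5Hk163Alias
  (vCbar_eq_v exp_shift_eq_inv_w norm_vCbar_le_omega norm_uCbar_le_prod norm_dC_mul_uCbar_le_prod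
    norm_rho_le_W inv_norm_DeltaXi_shift_le)
open Literature.MathematicalPhysics.QuantumFieldTheory.Balaban1983to89.B5Hk163Decay
  (phase163 norm_phase163_le differentiable_phase163 phase163_tr)
open Literature.MathematicalPhysics.QuantumFieldTheory.Balaban1983to89.B5G183Strip
  (uC dCbar RG YG FG pairD diagG B1 B2 midG g183 kappa183 kappa183_pos kappa183_le_rOf denominators_lower
    conjVec conjVec_mem_fat shift_conjVec vC_eq_conj uC_eq_conj dCbar_eq_conj norm_expFac_le_four MFG MFG_pos
    norm_YG_le Mmid183)
open Literature.MathematicalPhysics.QuantumFieldTheory.Balaban1983to89.B5G183AliasSum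
  (wt wt_nonneg wt_zero wt_of_ne wt_le_one diagReg diagReg_zero diagReg_of_ne freeDiag g183reg g183reg_eq)
open Literature.MathematicalPhysics.QuantumFieldTheory.Balaban1983to89.B5G183CovSplit
  (resolv freeN g183cov g183cov_eq freeDiag_sub_freeN inv_sub_resolv norm_DeltaXi0_add_one_ge
    norm_DeltaXi_shift_add_one_ge inv_W_pow_le_prod sum_prod_inv_sq_le Mcov183 Mcov183_nonneg differentiableAt_g183cov)
open Literature.MathematicalPhysics.QuantumFieldTheory.Balaban1983to89.B5G183CovDecay
  (phaseNeg norm_phaseNeg_le differentiable_phaseNeg Mcov Mcov_tr norm_Mcov_le differentiableAt_Mcov MD183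
    MD183_nonneg stripRegular_Mcov)
open Literature.MathematicalPhysics.QuantumFieldTheory.Balaban1983to89.T4Rate166StripDirect
  hiding rho rho_nonneg

noncomputable section

open Literature.MathematicalPhysics.QuantumFieldTheory.Balaban1983to89.T4Hk163StripRate
  (exp_neg_I_div_add_period w_eq_exp_wc w_iota_eq_exp_wc exp_shift_eq_exp_wc exp_shift_iotaK_eq_exp_wc gm
    En vCbar_eq_gm vCbar_iotaK_eq_gm gm_eq_quotient gm_zero norm_En_sq norm_En_ge norm_En_add_le
    norm_En_sub_En_le Cv Cv_nonneg norm_gm_sub_gm_le div_omega_iota_le vCbar_RB dC_mul_vCbar_eq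
    dC_mul_vCbar_iotaK_eq Cp Cp_nonneg norm_dC_mul_vCbar_sub_le dC_mul_vCbar_RB phase163_iotaK_eq Pom prof
    Pom_pos prof_nonneg prod_erase_eq_Pom one_le_sqrtW omega_le_sqrtW sq_sqrtW omega_le_level W_le sqrtW_le
    inv_level_le inv_sqrtW_le_prod_rpow prof_le_prod_rpow sum_omega_rpow_le' Cprof Cprof_nonneg sum_prof_le
    Pom_iotaK_le inv_W_unpaired_le RB_sub RB_div RB_inv SWinv_RB Krho Krho_nonneg rho_RB cω_le cω_iotaK_le
    T166K_RB XT Xne_eq_sum KX1 KX1_nonneg XT_RB norm_XT_le norm_XT_unpaired_le Xne_split KX KX_nonneg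
    Xne_rate Xne_RB KNcal KNcal_nonneg BN Ncal_RB div_sq_le_mul_inv RB_nmul RB_ndiv RB_one omega_mul_tt_le
    omega_mul_ts_le omega_sq_mul_tt_le iotaK_zero Pom_zero uCbar_RB prodErase_RB sum_inv_c_le_sqrtW)

variable {d : ℕ}

/-! ## §2 More rules of the calculus; the profiles with the zero alias included -/

/-! ### §2.1 Rules -/

/-- conjugation preserves packages. [folklore] -/
theorem RB_conj {a b : ℂ} {B ρ : ℝ} (h : RB a b B ρ) :
    RB ((starRingEnd ℂ) a) ((starRingEnd ℂ) b) B ρ :=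
  ⟨by rw [Complex.norm_conj]; exact h.left, by rw [Complex.norm_conj]; exact h.right,
    by rw [← map_sub, Complex.norm_conj]; exact h.sub⟩

/-- negation preserves packages. [folklore] -/
theorem RB_neg {a b : ℂ} {B ρ : ℝ} (h : RB a b B ρ) : RB (-a) (-b) B ρ :=
  ⟨by rw [norm_neg]; exact h.left, by rw [norm_neg]; exact h.right,
    by rw [show -a - -b = -(a - b) by ring, norm_neg]; exact h.sub⟩

/-- a package from a bound on the difference alone. [folklore] -/
theorem RB_of_norm_sub {a b : ℂ} {ρ : ℝ} (h : ‖a - b‖ ≤ ρ) : RB a b (max ‖a‖ ‖b‖) ρ :=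
  ⟨le_max_left _ _, le_max_right _ _, h⟩

/-- powers, sharp count: `‖a^N − b^N‖ ≤ N·B^{N−1}·ρ`. [folklore] -/
theorem RB_pow' {a b : ℂ} {B ρ : ℝ} (h : RB a b B ρ) (N : ℕ) :
    RB (a ^ N) (b ^ N) (B ^ N) (N * B ^ (N - 1) * ρ) := by
  induction N with
  | zero => exact ⟨by simp, by simp, by simp⟩
  | succ j ih =>
    have hm := ih.mul h
    rw [pow_succ, pow_succ, pow_succ, Nat.add_sub_cancel]
    refine hm.mono le_rfl ?_
    have hB := h.B_nonneg; have hρ := h.ρ_nonneg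
    rcases j with _ | j
    · simp
    · rw [Nat.add_sub_cancel]; push_cast; exact le_of_eq (by ring)

/-! ### §2.2 The profiles `tw`, `bw = Pom·wt`, `rw = Pom·tw⁻¹` -/

section Profiles

variable (N : ℕ) [NeZero N]

/-- `tw_N(K)`: `1` at `K = 0`, `√W_N(K)` otherwise (the decay scale of the alias, zero alias included). [folklore] -/
def tw (K : Fin d → Fin N) : ℝ := if K = fun _ => 0 then 1 else Real.sqrt (W N K)

/-- the BOUND profile `bw_N(K) = Pom_N(K)·wt_N(K)` (`= Pom/W` off zero, `12^d` at zero). [folklore] -/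
def bw (K : Fin d → Fin N) : ℝ := Pom N K * wt N K

/-- the RATE profile `rw_N(K) = Pom_N(K)·tw_N(K)⁻¹` (`= prof` off zero, `12^d` at zero). [folklore] -/
def rw (K : Fin d → Fin N) : ℝ := Pom N K * (tw N K)⁻¹

/-- `1 ≤ tw`. [folklore] -/
theorem one_le_tw (K : Fin d → Fin N) : 1 ≤ tw N K := by
  unfold tw; split_ifs with hK
  · exact le_rfl
  · exact one_le_sqrtW N hK

/-- `0 < tw`. [folklore] -/
theorem tw_pos (K : Fin d → Fin N) : 0 < tw N K := lt_of_lt_of_le one_pos (one_le_tw N K)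

/-- `tw(0) = 1`. [folklore] -/
theorem tw_zero : tw N (fun _ : Fin d => (0 : Fin N)) = 1 := by unfold tw; exact if_pos rfl

/-- `tw(K) = √W(K)` off zero. [folklore] -/
theorem tw_of_ne {K : Fin d → Fin N} (hK : K ≠ fun _ => 0) : tw N K = Real.sqrt (W N K) := by
  unfold tw; exact if_neg hK

/-- `wt = tw⁻¹·tw⁻¹`. [folklore] -/
theorem wt_eq (K : Fin d → Fin N) : wt N K = (tw N K)⁻¹ * (tw N K)⁻¹ := by
  unfold tw; split_ifs with hK
  · rw [hK, wt_zero]; norm_num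
  · rw [wt_of_ne N K hK, ← mul_inv, ← sq, sq_sqrtW, one_div]

/-- `ω_N(K_ν) ≤ tw_N(K)`. [folklore] -/
theorem omega_le_tw (K : Fin d → Fin N) (ν : Fin d) : omega N (K ν) ≤ tw N K := by
  unfold tw; split_ifs with hK
  · rw [hK]
    simp only [Fin.val_zero, omega_zero N (Nat.one_le_iff_ne_zero.mpr (NeZero.ne N))]; exact le_rfl
  · exact omega_le_sqrtW N hK ν

/-- the TRADE `N⁻¹ ≤ (d+1)·tw_N(K)⁻¹` (the decay scale never exceeds `d·N`). [folklore] -/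
theorem inv_level_le_tw (K : Fin d → Fin N) : ((N : ℝ))⁻¹ ≤ ((d : ℝ) + 1) * (tw N K)⁻¹ := by
  have hd : (0 : ℝ) ≤ d := Nat.cast_nonneg d
  unfold tw; split_ifs with hK
  · rw [inv_one, mul_one]
    have hN : (1 : ℝ) ≤ N := by exact_mod_cast Nat.one_le_iff_ne_zero.mpr (NeZero.ne N)
    exact (inv_le_one_of_one_le₀ hN).trans (by linarith)
  · have h0 : 0 ≤ (Real.sqrt (W N K))⁻¹ := inv_nonneg.mpr (Real.sqrt_nonneg _)
    calc ((N : ℝ))⁻¹ ≤ d * (Real.sqrt (W N K))⁻¹ := inv_level_le N hK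
      _ ≤ ((d : ℝ) + 1) * (Real.sqrt (W N K))⁻¹ := by nlinarith

/-- `Σ_ν ω_N(K_ν)/12 ≤ d·tw_N(K)/12`. [folklore] -/
theorem sum_inv_c_le_tw (K : Fin d → Fin N) : ∑ ν, (12 / omega N (K ν))⁻¹ ≤ d * tw N K / 12 := by
  unfold tw; split_ifs with hK
  · rw [hK]
    simp only [Fin.val_zero, omega_zero N (Nat.one_le_iff_ne_zero.mpr (NeZero.ne N)), div_one,
      Finset.sum_const, Finset.card_univ, Fintype.card_fin, nsmul_eq_mul]
    exact le_of_eq (by ring)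
  · exact sum_inv_c_le_sqrtW hK

/-- `0 < bw`. [folklore] -/
theorem bw_pos (K : Fin d → Fin N) : 0 < bw N K := by
  unfold bw; rw [wt_eq]; have := Pom_pos N K; have := tw_pos N K; positivity

/-- `0 < rw`. [folklore] -/
theorem rw_pos (K : Fin d → Fin N) : 0 < rw N K := by
  unfold rw; have := Pom_pos N K; have := tw_pos N K; positivity

/-- `bw ≤ rw`. [folklore] -/
theorem bw_le_rw (K : Fin d → Fin N) : bw N K ≤ rw N K := by
  unfold bw rw; rw [wt_eq]
  have h1 := one_le_tw N K; have hP := Pom_pos N K; have ht := tw_pos N K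
  have hi1 : (tw N K)⁻¹ ≤ 1 := inv_le_one_of_one_le₀ h1
  have hi0 : 0 ≤ (tw N K)⁻¹ := by positivity
  calc Pom N K * ((tw N K)⁻¹ * (tw N K)⁻¹) ≤ Pom N K * ((tw N K)⁻¹ * 1) := by gcongr
    _ = Pom N K * (tw N K)⁻¹ := by ring

/-- `rw ≤ Pom`. [folklore] -/
theorem rw_le_Pom (K : Fin d → Fin N) : rw N K ≤ Pom N K :=
  mul_le_of_le_one_right (Pom_pos N K).le (inv_le_one_of_one_le₀ (one_le_tw N K))

/-- `rw(0) = 12^d`. [folklore] -/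
theorem rw_zero : rw N (fun _ : Fin d => (0 : Fin N)) = 12 ^ d := by
  unfold rw; rw [Pom_zero, tw_zero, inv_one, mul_one]

/-- `bw(0) = 12^d`. [folklore] -/
theorem bw_zero : bw N (fun _ : Fin d => (0 : Fin N)) = 12 ^ d := by
  unfold bw; rw [Pom_zero, wt_zero, mul_one]

/-- `rw = prof` off zero. [folklore] -/
theorem rw_of_ne {K : Fin d → Fin N} (hK : K ≠ fun _ => 0) : rw N K = prof N K := by
  unfold rw prof; rw [tw_of_ne N hK]

/-- `bw = Pom·W⁻¹` off zero. [folklore] -/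
theorem bw_of_ne {K : Fin d → Fin N} (hK : K ≠ fun _ => 0) : bw N K = Pom N K * (W N K)⁻¹ := by
  unfold bw; rw [wt_of_ne N K hK, one_div]

/-- the summability constant of the rate profile. [folklore] -/
def Crw (d : ℕ) : ℝ := 12 ^ d + Cprof d

omit [NeZero N] in
/-- `0 ≤ Crw`. [folklore] -/
theorem Crw_nonneg (d : ℕ) : 0 ≤ Crw d := by unfold Crw; have := Cprof_nonneg d; positivity

/-- **UNIFORM SUMMABILITY OF THE RATE PROFILE**: `Σ_K rw_N(K) ≤ Crw(d)`, every level `N ≥ 1`. [folklore] -/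
theorem sum_rw_le : ∑ K : Fin d → Fin N, rw N K ≤ Crw d := by
  rw [← Finset.add_sum_erase _ _ (Finset.mem_univ (fun _ : Fin d => (0 : Fin N))), rw_zero]
  have h : ∑ K ∈ univ.erase (fun _ : Fin d => (0 : Fin N)), rw N K ≤ Cprof d :=
    calc ∑ K ∈ univ.erase (fun _ : Fin d => (0 : Fin N)), rw N K
        = ∑ K ∈ univ.erase (fun _ : Fin d => (0 : Fin N)), prof N K :=
          Finset.sum_congr rfl (fun K hK => rw_of_ne N (Finset.ne_of_mem_erase hK))
      _ ≤ ∑ K, prof N K :=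
          Finset.sum_le_sum_of_subset_of_nonneg (Finset.erase_subset _ _) (fun K _ _ => prof_nonneg N K)
      _ ≤ Cprof d := sum_prof_le N
  unfold Crw; linarith

/-- `Σ_K bw_N(K) ≤ Crw(d)`. [folklore] -/
theorem sum_bw_le : ∑ K : Fin d → Fin N, bw N K ≤ Crw d :=
  (Finset.sum_le_sum (fun K _ => bw_le_rw N K)).trans (sum_rw_le N)

end Profiles

/-- the pairing does not decrease the decay scale: `tw_n(k) ≤ tw_m(ι k)`. [folklore] -/
theorem tw_le_tw_iotaK {n m : ℕ} [NeZero n] [NeZero m] (hnm : n ≤ m) (k : Fin d → Fin n) :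
    tw n k ≤ tw m (iotaK n m hnm k) := by
  by_cases hk : k = fun _ => 0
  · rw [hk, iotaK_zero hnm, tw_zero, tw_zero]
  · rw [tw_of_ne n hk, tw_of_ne m (iotaK_ne_zero hnm hk)]
    exact Real.sqrt_le_sqrt (W_le_W_iotaK hnm k)

/-- `rw_m(ι k) ≤ rw_n(k)`. [folklore] -/
theorem rw_iotaK_le {n m : ℕ} [NeZero n] [NeZero m] (hnm : n ≤ m) (k : Fin d → Fin n) :
    rw m (iotaK n m hnm k) ≤ rw n k := by
  unfold rw
  exact mul_le_mul (Pom_iotaK_le hnm k) (inv_anti₀ (tw_pos n k) (tw_le_tw_iotaK hnm k))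
    (inv_nonneg.mpr (tw_pos m _).le) (Pom_pos n k).le

/-- `bw_m(ι k) ≤ bw_n(k)`. [folklore] -/
theorem bw_iotaK_le {n m : ℕ} [NeZero n] [NeZero m] (hnm : n ≤ m) (k : Fin d → Fin n) :
    bw m (iotaK n m hnm k) ≤ bw n k := by
  unfold bw; rw [wt_eq, wt_eq]
  have h := inv_anti₀ (tw_pos n k) (tw_le_tw_iotaK hnm k)
  have h0 : 0 ≤ (tw m (iotaK n m hnm k))⁻¹ := inv_nonneg.mpr (tw_pos m _).le
  exact mul_le_mul (Pom_iotaK_le hnm k) (mul_le_mul h h h0 (inv_nonneg.mpr (tw_pos n k).le))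
    (mul_nonneg h0 h0) (Pom_pos n k).le

/-- the zero index is paired (`n ≥ 1`). [folklore] -/
theorem paired_zero {n m : ℕ} (hn : 1 ≤ n) : Paired n m 0 := Or.inl (by omega)

/-- **THE UNPAIRED GAIN in profile form**: at an unpaired alias `K` of level `m`, `bw_m(K) ≤ (2/n)·rw_m(K)`. [folklore] -/
theorem bw_unpaired_le {n m : ℕ} [NeZero m] (hn : 1 ≤ n) {K : Fin d → Fin m}
    (hP : ¬ ∀ ν, Paired n m (K ν)) : bw m K ≤ 2 / n * rw m K := by
  have hK : K ≠ fun _ => 0 := by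
    rintro rfl
    exact hP (fun ν => by simpa using paired_zero (m := m) hn)
  rw [bw_of_ne m hK]; unfold rw; rw [tw_of_ne m hK]
  calc Pom m K * (W m K)⁻¹ ≤ Pom m K * (2 / n * (Real.sqrt (W m K))⁻¹) :=
        mul_le_mul_of_nonneg_left (inv_W_unpaired_le hn hK hP) (Pom_pos m K).le
    _ = 2 / n * (Pom m K * (Real.sqrt (W m K))⁻¹) := by ring

/-- the paired part of the FULL index box is the image of the pairing map (zero alias included). [folklore] -/
theorem filter_paired_univ {n m : ℕ} [NeZero n] [NeZero m] (hnm : n ≤ m) :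
    (univ : Finset (Fin d → Fin m)).filter (fun K => ∀ ν, Paired n m (K ν)) = univ.image (iotaK n m hnm) := by
  ext K
  simp only [Finset.mem_filter, Finset.mem_univ, true_and, Finset.mem_image]
  constructor
  · intro hPK
    by_cases hK : K = fun _ => 0
    · exact ⟨fun _ => 0, by rw [iotaK_zero hnm, hK]⟩
    · have hmem : K ∈ (((univ : Finset (Fin d → Fin m)).erase (fun _ => 0)).filter
          (fun k' => ∀ ν, Paired n m (k' ν))) :=
        Finset.mem_filter.mpr ⟨Finset.mem_erase.mpr ⟨hK, Finset.mem_univ _⟩, hPK⟩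
      rw [filter_paired_eq_image hnm] at hmem
      obtain ⟨k, -, hk⟩ := Finset.mem_image.mp hmem
      exact ⟨k, hk⟩
  · rintro ⟨k, rfl⟩ ν
    rw [iotaK_val]; exact paired_iota hnm

/-- **CONJUGATE PHASE MATCHING** under `b′·n = b·m`: `e^{−i(p′+ι l′)·b′/m} = e^{−i(p′+l′)·b/n}`. [folklore] -/
theorem phaseNeg_iotaK_eq {n m : ℕ} [NeZero n] [NeZero m] (hnm : n ≤ m) (k : Fin d → Fin n) (b : Fin d → Fin n)
    (b' : Fin d → Fin m) (hphys : ∀ ν, (b' ν : ℕ) * n = (b ν : ℕ) * m) (p : Fin d → ℂ) :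
    phaseNeg m (iotaK n m hnm k) b' p = phaseNeg n k b p := by
  unfold phaseNeg
  refine Finset.prod_congr rfl (fun ν _ => ?_)
  rw [Complex.exp_neg, Complex.exp_neg, exp_shift_iotaK_eq_exp_wc, exp_shift_eq_exp_wc, inv_pow, inv_pow,
    ← Complex.exp_nat_mul, ← Complex.exp_nat_mul]
  congr 2
  have hn : (n : ℂ) ≠ 0 := Nat.cast_ne_zero.mpr (NeZero.ne n)
  have hm : (m : ℂ) ≠ 0 := Nat.cast_ne_zero.mpr (NeZero.ne m)
  have h : ((b' ν : ℕ) : ℂ) * n = ((b ν : ℕ) : ℂ) * m := by exact_mod_cast hphys ν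
  have hq : ((b' ν : ℕ) : ℂ) / m = ((b ν : ℕ) : ℂ) / n := by
    rw [div_eq_div_iff hm hn]; exact h
  calc ((b' ν : ℕ) : ℂ) * (I * wc n (k ν) (p ν) / m) = ((b' ν : ℕ) : ℂ) / m * (I * wc n (k ν) (p ν)) := by ring
    _ = ((b ν : ℕ) : ℂ) / n * (I * wc n (k ν) (p ν)) := by rw [hq]
    _ = ((b ν : ℕ) : ℂ) * (I * wc n (k ν) (p ν) / n) := by ring

/-! ### §2.3 The conjugate leaves and the product `ū·v̄_μ` -/

/-- the package of `A·V` from packages of `A` (bound `Pom`, rate `(Cv/n)·Pom·Σω/12`) and `V` (bound `12/ω_μ`, rate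
`Cv/n`): bound `12·Pom`, rate `Cv(d+1)·n⁻¹·Pom·tw`. [folklore] -/
theorem uv_RB_of {n : ℕ} [NeZero n] (k : Fin d → Fin n) (μ : Fin d) {A₁ A₂ V₁ V₂ : ℂ}
    (hA : RB A₁ A₂ (Pom n k) (Cv / n * Pom n k * ∑ ν, (12 / omega n (k ν))⁻¹))
    (hV : RB V₁ V₂ (12 / omega n (k μ)) (Cv / n)) :
    RB (A₁ * V₁) (A₂ * V₂) (12 * Pom n k) (Cv * ((d : ℝ) + 1) * (((n : ℝ))⁻¹ * (Pom n k * tw n k))) := by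
  have h := hA.mul hV
  have hω1 := one_le_omega n _ (k μ).isLt
  have hω0 : 0 < omega n (k μ) := by linarith
  have hS := sum_inv_c_le_tw n k
  have ht := one_le_tw n k
  have hP := Pom_pos n k
  have hCv := Cv_nonneg
  have h12 : 12 / omega n (k μ) ≤ 12 := div_le_self (by norm_num) hω1
  have hS0 : 0 ≤ ∑ ν, (12 / omega n (k ν))⁻¹ :=
    Finset.sum_nonneg (fun ν _ => by have := omega_pos n (k ν) (k ν).isLt; positivity)
  have hn0 : (0 : ℝ) ≤ Cv / n := by positivity
  refine h.mono ?_ ?_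
  · rw [mul_comm]; exact mul_le_mul_of_nonneg_right h12 hP.le
  · have e1 : Pom n k * (Cv / n) ≤ Pom n k * (Cv / n) * tw n k :=
      le_mul_of_one_le_right (by positivity) ht
    have e2 : Cv / n * Pom n k * (∑ ν, (12 / omega n (k ν))⁻¹) * (12 / omega n (k μ))
        ≤ Cv / n * Pom n k * (d * tw n k / 12) * 12 :=
      mul_le_mul (mul_le_mul_of_nonneg_left hS (by positivity)) h12 (by positivity) (by positivity)
    calc Pom n k * (Cv / n) + Cv / n * Pom n k * (∑ ν, (12 / omega n (k ν))⁻¹) * (12 / omega n (k μ))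
        ≤ Pom n k * (Cv / n) * tw n k + Cv / n * Pom n k * (d * tw n k / 12) * 12 := add_le_add e1 e2
      _ = Cv * ((d : ℝ) + 1) * (((n : ℝ))⁻¹ * (Pom n k * tw n k)) := by simp only [div_eq_mul_inv]; ring

section FatPkg

variable {n m : ℕ} [NeZero n] [NeZero m] (hn : 2 ≤ n) (hnm : n ≤ m) {r : ℝ} (hr : r ≤ 1 / 4)
  {p : Fin d → ℂ} (hp : p ∈ Fat d r)
include hn hnm hr hp

/-- package of `v_μ(p′+l)` (conjugate leaf): bound `12/ω_n(l_μ)`, rate `Cv/n`. [folklore] -/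
theorem vC_RB (k : Fin d → Fin n) (μ : Fin d) :
    RB (vC m (iotaK n m hnm k) p μ) (vC n k p μ) (12 / omega n (k μ)) (Cv / n) := by
  rw [vC_eq_conj, vC_eq_conj]
  exact RB_conj (vCbar_RB hn hnm hr (conjVec_mem_fat hp) k μ)

/-- package of `u(p′+l)` (conjugate leaf): bound `Pom`, rate `(Cv/n)·Pom·Σ_ν ω_ν/12`. [folklore] -/
theorem uC_RB (k : Fin d → Fin n) :
    RB (uC m (iotaK n m hnm k) p) (uC n k p) (Pom n k) (Cv / n * Pom n k * ∑ ν, (12 / omega n (k ν))⁻¹) := by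
  rw [uC_eq_conj, uC_eq_conj]
  exact RB_conj (uCbar_RB hn hnm hr (conjVec_mem_fat hp) k)

/-- package of `conj ∂_μ · v_μ` (conjugate leaf): bound `4`, rate `Cp·ω_n(l_μ)/n`. [folklore] -/
theorem dCbar_mul_vC_RB (k : Fin d → Fin n) (μ : Fin d) :
    RB (dCbar m (iotaK n m hnm k) p μ * vC m (iotaK n m hnm k) p μ) (dCbar n k p μ * vC n k p μ) 4
      (Cp * omega n (k μ) / n) := by
  rw [dCbar_eq_conj, vC_eq_conj, ← map_mul, dCbar_eq_conj, vC_eq_conj, ← map_mul]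
  exact RB_conj (dC_mul_vCbar_RB hn hnm hr (conjVec_mem_fat hp) k μ)

/-- package of `Π_{ν≠μ} v_ν(p′+l)` (conjugate leaf). [folklore] -/
theorem prodEraseC_RB (k : Fin d → Fin n) (μ : Fin d) :
    RB (∏ ν ∈ univ.erase μ, vC m (iotaK n m hnm k) p ν) (∏ ν ∈ univ.erase μ, vC n k p ν)
      (omega n (k μ) / 12 * Pom n k)
      (Cv / n * (omega n (k μ) / 12 * Pom n k) * ∑ ν, (12 / omega n (k ν))⁻¹) := by
  have e : ∀ (N : ℕ) (K : Fin d → Fin N), ∏ ν ∈ univ.erase μ, vC N K p ν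
      = (starRingEnd ℂ) (∏ ν ∈ univ.erase μ, vCbar N K (conjVec p) ν) := by
    intro N K; rw [map_prod]; exact Finset.prod_congr rfl (fun ν _ => vC_eq_conj N K p ν)
  rw [e, e]
  exact RB_conj (prodErase_RB hn hnm hr (conjVec_mem_fat hp) k μ)

/-- `ū(p′+l)·v̄_μ(p′+l)`: bound `12·Pom`, rate `Cv(d+1)·n⁻¹·Pom·tw`. [folklore] -/
theorem uv_RB (k : Fin d → Fin n) (μ : Fin d) :
    RB (uCbar m (iotaK n m hnm k) p * vCbar m (iotaK n m hnm k) p μ) (uCbar n k p * vCbar n k p μ)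
      (12 * Pom n k) (Cv * ((d : ℝ) + 1) * (((n : ℝ))⁻¹ * (Pom n k * tw n k))) :=
  uv_RB_of k μ (uCbar_RB hn hnm hr hp k) (vCbar_RB hn hnm hr hp k μ)

/-- `u(p′+l′)·v_μ(p′+l′)`: bound `12·Pom`, rate `Cv(d+1)·n⁻¹·Pom·tw`. [folklore] -/
theorem uvC_RB (k : Fin d → Fin n) (μ : Fin d) :
    RB (uC m (iotaK n m hnm k) p * vC m (iotaK n m hnm k) p μ) (uC n k p * vC n k p μ)
      (12 * Pom n k) (Cv * ((d : ℝ) + 1) * (((n : ℝ))⁻¹ * (Pom n k * tw n k))) :=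
  uv_RB_of k μ (uC_RB hn hnm hr hp k) (vC_RB hn hnm hr hp k μ)

end FatPkg


/-! ### §2.4 Packages of the scalar denominators of (1.83) on the zero-free strip -/

/-- the rate constant of `Y^G_λ = Δ + Y_λ`. [folklore] -/
def KYG (d : ℕ) : ℝ := KΔ d + KY d

/-- `0 ≤ KYG`. [folklore] -/
theorem KYG_nonneg (d : ℕ) : 0 ≤ KYG d := by
  unfold KYG; have := KΔ_nonneg d; have := KY_nonneg d; positivity

/-- the rate constant of `F^G`. [folklore] -/
def KFG (d : ℕ) : ℝ := d * (2 * Bc d) ^ d * KU d + d * ((2 * Bc d) * (2 ^ d * (3 * d * ((2 * Bc d) ^ d) ^ 3 * K1 d)))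

/-- `0 ≤ KFG`. [folklore] -/
theorem KFG_nonneg (d : ℕ) : 0 ≤ KFG d := by
  unfold KFG KU K1
  have := KΔ_nonneg d; have := KR_nonneg d; have := Kcf_nonneg d; have := Bc_pos d; have := Cinv_pos
  positivity

/-- the rate constant of the middle scalar `Π_λ Y^G_λ / F^G`. [folklore] -/
def Kmid (d : ℕ) : ℝ := d * (3 * Bc d ^ 2) ^ d * KYG d / cF163 d + (3 * Bc d ^ 2) ^ d * KFG d / cF163 d ^ 2

/-- `0 ≤ Kmid`. [folklore] -/
theorem Kmid_nonneg (d : ℕ) : 0 ≤ Kmid d := by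
  unfold Kmid
  have := KYG_nonneg d; have := KFG_nonneg d; have := Bc_pos d; have := cF163_pos d
  positivity

/-- the rate constant of the truncated resolvent `R_N(Δ(p′))`. [folklore] -/
def Kres (d N : ℕ) : ℝ := N * (N * (64 / 39) ^ N * (KΔ d * (64 / 39) ^ 2))

/-- `0 ≤ Kres`. [folklore] -/
theorem Kres_nonneg (d N : ℕ) : 0 ≤ Kres d N := by unfold Kres; have := KΔ_nonneg d; positivity

section StripPkg

variable {n m : ℕ} [NeZero n] [NeZero m] (hn : 2 ≤ n) (hnm : n ≤ m) {κ : ℝ} (hκ0 : 0 ≤ κ)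
  (hκ : κ ≤ kappa183 d) {p : Fin d → ℂ} (hp : p ∈ Strip d κ)
include hn hnm hκ0 hκ hp

omit hκ0 in
/-- package of `R^G_λ = 1 + R̃_λ`: bound `2B_c`, rate `KR/n²`. [folklore] -/
theorem RG_RB (lam : Fin d) : RB (RG m lam p) (RG n lam p) (2 * Bc d) (KR d / (n : ℝ) ^ 2) := by
  have hq := (strip_subset_fat (rOf_pos d).le (hκ.trans (kappa183_le_rOf d)) hp)
  unfold RG
  have h := RB_one.add (Rt_RB hn hnm (rOf_le d) (d_mul_rOf_sq_le d) hq lam)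
  have hB := one_le_Bc d
  exact h.mono (by linarith) (le_of_eq (by ring))

omit hκ0 in
/-- package of `Y^G_λ = Δ + Y_λ`: bound `3B_c²`, rate `KYG/n²`. [folklore] -/
theorem YG_RB (lam : Fin d) : RB (YG m lam p) (YG n lam p) (3 * Bc d ^ 2) (KYG d / (n : ℝ) ^ 2) := by
  have hq := (strip_subset_fat (rOf_pos d).le (hκ.trans (kappa183_le_rOf d)) hp)
  unfold YG
  have h := (DeltaXi0_RB hn hnm (rOf_le d) hq).add (Yc_RB hn hnm (rOf_le d) (d_mul_rOf_sq_le d) hq lam)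
  have hB := one_le_Bc d
  exact h.mono (by nlinarith) (le_of_eq (by unfold KYG; ring))

omit hκ0 in
/-- package of `Π_λ Y^G_λ`: bound `(3B_c²)^d`, rate `d(3B_c²)^d KYG/n²`. [folklore] -/
theorem prodYG_RB : RB (∏ lam, YG m lam p) (∏ lam, YG n lam p) ((3 * Bc d ^ 2) ^ d)
    (d * (3 * Bc d ^ 2) ^ d * (KYG d / (n : ℝ) ^ 2)) := by
  have hB : 1 ≤ 3 * Bc d ^ 2 := by have := one_le_Bc d; nlinarith
  have hρ : 0 ≤ KYG d / (n : ℝ) ^ 2 := by have := KYG_nonneg d; positivity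
  have h := RB.prod univ hB hρ (fun lam _ => YG_RB hn hnm hκ hp lam)
  rwa [Finset.card_univ, Fintype.card_fin] at h

/-- package of `(Y^G_λ)⁻¹`: bound `1/c_Y`, rate `KYG/n²/c_Y²`. [folklore] -/
theorem YGinv_RB (lam : Fin d) : RB ((YG m lam p)⁻¹) ((YG n lam p)⁻¹) (1 / cY163 d)
    (KYG d / (n : ℝ) ^ 2 / cY163 d ^ 2) := by
  obtain ⟨-, -, hYm, -⟩ := denominators_lower m hκ0 hκ hp
  obtain ⟨-, -, hYn, -⟩ := denominators_lower n hκ0 hκ hp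
  exact RB_inv (cY163_pos d) (YG_RB hn hnm hκ hp lam) (hYm lam) (hYn lam)

/-- package of `𝒩⁻¹`: bound `1/c_N`, rate `KNcal/n²/c_N²`. [folklore] -/
theorem Ninv_RB : RB ((Ncal m p)⁻¹) ((Ncal n p)⁻¹) (1 / cN163 d) (KNcal d / (n : ℝ) ^ 2 / cN163 d ^ 2) := by
  have hq := (strip_subset_fat (rOf_pos d).le (hκ.trans (kappa183_le_rOf d)) hp)
  obtain ⟨-, hNm, -, -⟩ := denominators_lower m hκ0 hκ hp
  obtain ⟨-, hNn, -, -⟩ := denominators_lower n hκ0 hκ hp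
  exact RB_inv (cN163_pos d) (Ncal_RB hn hnm (rOf_le d) (d_mul_rOf_sq_le d) hq) hNm hNn

omit hκ0 in
/-- a monomial `Δ^{|T|−1} Π_T R^G Π_{rest} c` of `F^G`: bound `((2B_c)^d)³`, rate `3d((2B_c)^d)³K1/n²`. [folklore] -/
theorem monomialG_RB (lam : Fin d) (T : Finset (Fin d)) :
    RB (DeltaXi m 0 p ^ (T.card - 1) * ((∏ lam' ∈ T, RG m lam' p) * ∏ lam' ∈ (univ.erase lam) \ T, cfac m lam' p))
       (DeltaXi n 0 p ^ (T.card - 1) * ((∏ lam' ∈ T, RG n lam' p) * ∏ lam' ∈ (univ.erase lam) \ T, cfac n lam' p))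
       (((2 * Bc d) ^ d) ^ 3) (3 * d * ((2 * Bc d) ^ d) ^ 3 * (K1 d / (n : ℝ) ^ 2)) := by
  have hq := (strip_subset_fat (rOf_pos d).le (hκ.trans (kappa183_le_rOf d)) hp)
  have hr := rOf_le d
  have hB1 := one_le_Bc d
  have hB : (1 : ℝ) ≤ 2 * Bc d := by linarith
  have hBB : Bc d ≤ 2 * Bc d := by linarith
  have hKΔ := KΔ_nonneg d; have hKR := KR_nonneg d; have hKc := Kcf_nonneg d
  have hcardT : T.card ≤ d := (Finset.card_le_univ T).trans (by simp)
  have hcardS : ((univ.erase lam) \ T).card ≤ d := (Finset.card_le_univ _).trans (by simp)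
  have i1 : KΔ d / (n : ℝ) ^ 2 ≤ K1 d / (n : ℝ) ^ 2 :=
    div_le_div_of_nonneg_right (by unfold K1; linarith) (by positivity)
  have i2 : KR d / (n : ℝ) ^ 2 ≤ K1 d / (n : ℝ) ^ 2 :=
    div_le_div_of_nonneg_right (by unfold K1; linarith) (by positivity)
  have i3 : Kcf d / (n : ℝ) ^ 2 ≤ K1 d / (n : ℝ) ^ 2 :=
    div_le_div_of_nonneg_right (by unfold K1; linarith) (by positivity)
  have e1 : RB (DeltaXi m 0 p ^ (T.card - 1)) (DeltaXi n 0 p ^ (T.card - 1)) ((2 * Bc d) ^ d)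
      (d * (2 * Bc d) ^ d * (K1 d / (n : ℝ) ^ 2)) :=
    (((DeltaXi0_RB hn hnm hr hq).mono hBB le_rfl).pow hB (T.card - 1)).mono_pow hB (by omega)
      (by positivity) i1
  have e2 : RB (∏ lam' ∈ T, RG m lam' p) (∏ lam' ∈ T, RG n lam' p) ((2 * Bc d) ^ d)
      (d * (2 * Bc d) ^ d * (K1 d / (n : ℝ) ^ 2)) :=
    (RB.prod T hB (by positivity) (fun lam' _ => RG_RB hn hnm hκ hp lam')).mono_pow hB hcardT
      (by positivity) i2
  have e3 : RB (∏ lam' ∈ (univ.erase lam) \ T, cfac m lam' p) (∏ lam' ∈ (univ.erase lam) \ T, cfac n lam' p)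
      ((2 * Bc d) ^ d) (d * (2 * Bc d) ^ d * (K1 d / (n : ℝ) ^ 2)) :=
    (RB.prod _ hB (by positivity) (fun lam' _ => (cfac_RB hn hnm hr hq lam').mono hBB le_rfl)).mono_pow hB
      hcardS (by positivity) i3
  have h := e1.mul (e2.mul e3)
  exact h.mono (le_of_eq (by ring)) (le_of_eq (by ring))

omit hκ0 in
/-- **THE RATE OF THE DENOMINATOR `F^G`** on the strip: bound `MFG`, rate `KFG/n²`. [folklore] -/
theorem FG_RB : RB (FG m p) (FG n p) (MFG d) (KFG d / (n : ℝ) ^ 2) := by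
  have hq := (strip_subset_fat (rOf_pos d).le (hκ.trans (kappa183_le_rOf d)) hp)
  have hr := rOf_le d
  have hB1 := one_le_Bc d
  have hB : (1 : ℝ) ≤ 2 * Bc d := by linarith
  have hB0 : (0 : ℝ) < 2 * Bc d := by linarith
  -- the `U_0^d` term
  have hU0 : RB (U m (fun _ => (0 : Fin m)) p ^ d) (U n (fun _ => (0 : Fin n)) p ^ d) ((2 * Bc d) ^ d)
      (d * (2 * Bc d) ^ d * (KU d / (n : ℝ) ^ 2)) := by
    have h4 : (4 : ℝ) ^ d ≤ 2 * Bc d :=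
      ((pow_le_pow_right₀ (by norm_num) (Nat.le_succ d)).trans (four_pow_succ_le_Bc d)).trans (by linarith)
    have h0 := (U0_RB hn hnm hr hq).mono h4 (le_of_eq (by unfold KU T4Rate166StripDirect.rho; ring) :
      (d : ℝ) * 4 ^ d * T4Rate166StripDirect.rho n ≤ KU d / (n : ℝ) ^ 2)
    exact h0.pow hB d
  have hcard : ∀ lam : Fin d, ((((univ.erase lam).powerset).erase ∅).card : ℝ) ≤ 2 ^ d := by
    intro lam
    have h1 : (((univ.erase lam).powerset).erase ∅).card ≤ ((univ.erase lam).powerset).card :=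
      Finset.card_erase_le
    rw [Finset.card_powerset] at h1
    have h2 : 2 ^ (univ.erase lam).card ≤ 2 ^ d :=
      Nat.pow_le_pow_right (by norm_num) ((Finset.card_le_univ _).trans (by simp))
    exact_mod_cast h1.trans h2
  have hK1n : 0 ≤ 3 * d * ((2 * Bc d) ^ d) ^ 3 * (K1 d / (n : ℝ) ^ 2) := by
    have := KΔ_nonneg d; have := KR_nonneg d; have := Kcf_nonneg d
    unfold K1; positivity
  have hinner : ∀ lam : Fin d,
      RB (S1 (p lam) * ∑ T ∈ ((univ.erase lam).powerset).erase ∅, DeltaXi m 0 p ^ (T.card - 1)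
            * ((∏ lam' ∈ T, RG m lam' p) * ∏ lam' ∈ (univ.erase lam) \ T, cfac m lam' p))
         (S1 (p lam) * ∑ T ∈ ((univ.erase lam).powerset).erase ∅, DeltaXi n 0 p ^ (T.card - 1)
            * ((∏ lam' ∈ T, RG n lam' p) * ∏ lam' ∈ (univ.erase lam) \ T, cfac n lam' p))
         ((2 * Bc d) * (2 ^ d * ((2 * Bc d) ^ d) ^ 3))
         ((2 * Bc d) * (2 ^ d * (3 * d * ((2 * Bc d) ^ d) ^ 3 * (K1 d / (n : ℝ) ^ 2)))) := by
    intro lam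
    have hs := RB.sum (((univ.erase lam).powerset).erase ∅) (fun T _ => monomialG_RB hn hnm hκ hp lam T)
    have hs' := hs.mono
      (mul_le_mul_of_nonneg_right (hcard lam) (by positivity) :
        ((((univ.erase lam).powerset).erase ∅).card : ℝ) * ((2 * Bc d) ^ d) ^ 3 ≤ 2 ^ d * ((2 * Bc d) ^ d) ^ 3)
      (mul_le_mul_of_nonneg_right (hcard lam) hK1n)
    have hS1 := RB.of_eq (S1 (p lam)) ((norm_S1_le_Bc hr hq lam).trans (by linarith : Bc d ≤ 2 * Bc d))
    have h := hS1.mul hs'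
    exact h.mono le_rfl (le_of_eq (by ring))
  have hsum := RB.sum (Finset.univ : Finset (Fin d)) (fun lam _ => hinner lam)
  rw [Finset.card_univ, Fintype.card_fin] at hsum
  have h := hU0.add hsum
  unfold FG
  refine h.mono (le_of_eq ?_) (le_of_eq ?_)
  · unfold MFG; ring
  · unfold KFG; ring

/-- **THE RATE OF THE MIDDLE SCALAR `Π_λ Y^G_λ / F^G`**: bound `Mmid183`, rate `Kmid/n²`. [folklore] -/
theorem midG_RB : RB (midG m p) (midG n p) (Mmid183 d) (Kmid d / (n : ℝ) ^ 2) := by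
  obtain ⟨hFm, -, -, -⟩ := denominators_lower m hκ0 hκ hp
  obtain ⟨hFn, -, -, -⟩ := denominators_lower n hκ0 hκ hp
  unfold midG
  have h := RB_div (cF163_pos d) (prodYG_RB hn hnm hκ hp) (FG_RB hn hnm hκ hp) hFm hFn
  refine h.mono (le_of_eq rfl) (le_of_eq ?_)
  unfold Kmid; simp only [div_eq_mul_inv]; ring

omit hκ0 in
/-- package of the shifted MASSIVE free propagator `(Δ(p′+l) + 1)⁻¹`, `l ≠ 0`: bound `(64/7)/W`, rate `CD/n²`
(`‖Δ(p′+l) + 1‖ ≥ 1 + 7W/64` at both levels, `B5G183CovSplit.norm_DeltaXi_shift_add_one_ge`). [folklore] -/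
theorem SW1i_RB {k : Fin d → Fin n} (hk : k ≠ fun _ => 0) :
    RB ((SW m n k p + 1)⁻¹) ((SW n n k p + 1)⁻¹) (64 / 7 / W n k) (CD d / (n : ℝ) ^ 2) := by
  have hq := (strip_subset_fat (rOf_pos d).le (hκ.trans (kappa183_le_rOf d)) hp)
  have hr := rOf_le d
  have hdr := d_mul_rOf_sq_le d
  have hW := one_le_W n k hk
  have hW0 : W n k ≠ 0 := (lt_of_lt_of_le one_pos hW).ne'
  have hn0 : (n : ℝ) ≠ 0 := Nat.cast_ne_zero.mpr (NeZero.ne n)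
  have hc : 0 < 7 / 64 * W n k := by positivity
  have hsub : ‖(SW m n k p + 1) - (SW n n k p + 1)‖
      ≤ d * (4 * 11 ^ 4 * Real.exp (Real.pi + 2)) * W n k ^ 2 / (n : ℝ) ^ 2 := by
    rw [add_sub_add_right_eq_sub]; exact norm_SW_sub_le hn hnm hr hq hk
  have ha : 7 / 64 * W n k ≤ ‖SW m n k p + 1‖ := by
    have h := norm_DeltaXi_shift_add_one_ge m hr hdr hq (iotaK n m hnm k) (iotaK_ne_zero hnm hk)
    rw [DeltaXi_shift_iotaK_eq_SW] at h
    have hW' := W_le_W_iotaK hnm k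
    nlinarith
  have hb : 7 / 64 * W n k ≤ ‖SW n n k p + 1‖ := by
    have h := norm_DeltaXi_shift_add_one_ge n hr hdr hq k hk
    rw [DeltaXi_shift_eq_SW] at h; linarith
  have h := RB_inv hc (RB_of_norm_sub hsub) ha hb
  refine h.mono (le_of_eq ?_) (le_of_eq ?_)
  · field_simp
  · unfold CD; field_simp

omit hκ0 in
/-- package of `(Δ(p′) + 1)⁻¹` (zero alias, massive): bound `64/39`, rate `KΔ(64/39)²/n²`. [folklore] -/
theorem D01i_RB : RB ((DeltaXi m 0 p + 1)⁻¹) ((DeltaXi n 0 p + 1)⁻¹) (64 / 39) (KΔ d * (64 / 39) ^ 2 / (n : ℝ) ^ 2) := by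
  have hq := (strip_subset_fat (rOf_pos d).le (hκ.trans (kappa183_le_rOf d)) hp)
  have hr := rOf_le d
  have hdr := d_mul_rOf_sq_le d
  have h := RB_inv (by norm_num : (0 : ℝ) < 39 / 64) ((DeltaXi0_RB hn hnm hr hq).add RB_one)
    (norm_DeltaXi0_add_one_ge m hr hdr hq) (norm_DeltaXi0_add_one_ge n hr hdr hq)
  refine h.mono (le_of_eq (by norm_num)) (le_of_eq ?_)
  field_simp; ring

omit hκ0 in
/-- package of the truncated resolvent `R_N(Δ(p′)) = Σ_{j<N} (Δ(p′)+1)^{−(j+1)}`: bound `N(64/39)^N`, rate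
`Kres/n²`. [folklore] -/
theorem resolv_RB (N : ℕ) : RB (resolv N (DeltaXi m 0 p)) (resolv N (DeltaXi n 0 p)) (N * (64 / 39) ^ N)
    (Kres d N / (n : ℝ) ^ 2) := by
  have hB : (1 : ℝ) ≤ 64 / 39 := by norm_num
  have hρ : 0 ≤ KΔ d * (64 / 39) ^ 2 / (n : ℝ) ^ 2 := by have := KΔ_nonneg d; positivity
  have hterm : ∀ j ∈ Finset.range N,
      RB (1 / (DeltaXi m 0 p + 1) ^ (j + 1)) (1 / (DeltaXi n 0 p + 1) ^ (j + 1)) ((64 / 39) ^ N)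
        (N * (64 / 39) ^ N * (KΔ d * (64 / 39) ^ 2 / (n : ℝ) ^ 2)) := by
    intro j hj
    have hjN : j + 1 ≤ N := Finset.mem_range.mp hj
    rw [one_div, one_div, ← inv_pow, ← inv_pow]
    exact ((D01i_RB hn hnm hκ hp).pow hB (j + 1)).mono_pow hB hjN hρ le_rfl
  have h := RB.sum (Finset.range N) hterm
  rw [Finset.card_range] at h
  unfold resolv
  refine h.mono le_rfl (le_of_eq ?_)
  unfold Kres; ring

end StripPkg


/-! ## §3 Packages of the factors of `g^{cov,N}` with alias decay -/

/-- bound constant of the pair factor `P(l,l′)`. [folklore] -/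
def βP (d : ℕ) : ℝ := Bc d * (64 / 7) ^ 2

/-- rate constant of the pair factor `P(l,l′)`. [folklore] -/
def κP (d : ℕ) : ℝ := Bc d * (64 / 7) * CD d + KΔ d * (64 / 7) ^ 2

/-- bound constant of the regular `δ_{μν}`-term. [folklore] -/
def βDg (d : ℕ) : ℝ := 144 * βP d / cY163 d

/-- rate constant of the regular `δ_{μν}`-term. [folklore] -/
def κDg (d : ℕ) : ℝ :=
  (288 * κP d * ((d : ℝ) + 1) + 24 * Cv * ((d : ℝ) + 1) * βP d) / cY163 d + 144 * βP d * KYG d / cY163 d ^ 2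

/-- rate constant of the zero-alias `δ_{μν}`-term `R^G_μ/Y^G_μ`. [folklore] -/
def κDg0 (d : ℕ) : ℝ := KR d / cY163 d + 2 * Bc d * KYG d / cY163 d ^ 2

/-- Nonnegativity of the constant / profile (bookkeeping). [folklore] -/
theorem βP_nonneg (d : ℕ) : 0 ≤ βP d := by unfold βP; have := Bc_pos d; positivity
/-- Nonnegativity of the constant / profile (bookkeeping). [folklore] -/
theorem κP_nonneg (d : ℕ) : 0 ≤ κP d := by
  unfold κP; have := Bc_pos d; have := CD_nonneg d; have := KΔ_nonneg d; positivity
/-- Nonnegativity of the constant / profile (bookkeeping). [folklore] -/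
theorem βDg_nonneg (d : ℕ) : 0 ≤ βDg d := by
  unfold βDg; have := βP_nonneg d; have := cY163_pos d; positivity
/-- Nonnegativity of the constant / profile (bookkeeping). [folklore] -/
theorem κDg_nonneg (d : ℕ) : 0 ≤ κDg d := by
  unfold κDg
  have := κP_nonneg d; have := βP_nonneg d; have := cY163_pos d; have := KYG_nonneg d; have := Cv_nonneg
  positivity
/-- Nonnegativity of the constant / profile (bookkeeping). [folklore] -/
theorem κDg0_nonneg (d : ℕ) : 0 ≤ κDg0 d := by
  unfold κDg0; have := KR_nonneg d; have := Bc_pos d; have := cY163_pos d; have := KYG_nonneg d; positivity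

section DecayPkg

variable {n m : ℕ} [NeZero n] [NeZero m] (hn : 2 ≤ n) (hnm : n ≤ m) {κ : ℝ} (hκ0 : 0 ≤ κ)
  (hκ : κ ≤ kappa183 d) {p : Fin d → ℂ} (hp : p ∈ Strip d κ)
include hn hnm hκ0 hκ hp

omit hκ0 in
/-- **THE PAIR FACTOR** `P(l,l′)` (not both aliases zero) under the pairing: bound `βP·wt(l)·wt(l′)`, rate
`κP/n²·(wt(l) + wt(l′))`. [folklore] -/
theorem pairD_RB {k k' : Fin d → Fin n} (hkk : ¬ (k = (fun _ => 0) ∧ k' = (fun _ => 0))) :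
    RB (pairD m (iotaK n m hnm k) (iotaK n m hnm k') p) (pairD n k k' p)
      (βP d * wt n k * wt n k') (κP d / (n : ℝ) ^ 2 * (wt n k + wt n k')) := by
  have hq := (strip_subset_fat (rOf_pos d).le (hκ.trans (kappa183_le_rOf d)) hp)
  have hr := rOf_le d
  have hB := one_le_Bc d
  have hCD := CD_nonneg d
  have hKΔ := KΔ_nonneg d
  have hu0 : 0 ≤ ((n : ℝ) ^ 2)⁻¹ := by positivity
  -- one shifted denominator only
  have single : ∀ {l : Fin d → Fin n} (hl : l ≠ fun _ => 0),
      RB ((SW m n l p)⁻¹) ((SW n n l p)⁻¹) (βP d * 1 * wt n l) (κP d / (n : ℝ) ^ 2 * (1 + wt n l)) := by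
    intro l hl
    have hW := one_le_W n l hl
    have hx0 : 0 ≤ (W n l)⁻¹ := by positivity
    rw [wt_of_ne n l hl]
    refine (SWinv_RB hn hnm (rOf_le d) (d_mul_rOf_sq_le d) (strip_subset_fat (rOf_pos d).le (hκ.trans (kappa183_le_rOf d)) hp) hl).mono ?_ ?_
    · unfold βP; simp only [div_eq_mul_inv, one_mul]
      nlinarith [mul_le_mul_of_nonneg_right hB (by positivity : (0 : ℝ) ≤ 64 * 7⁻¹ * (W n l)⁻¹)]
    · unfold κP; simp only [div_eq_mul_inv, one_mul]
      have h1 : CD d ≤ Bc d * (64 * 7⁻¹) * CD d + KΔ d * (64 * 7⁻¹) ^ 2 := by nlinarith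
      have h2 : (1 : ℝ) ≤ 1 + (W n l)⁻¹ := by linarith
      calc CD d * ((n : ℝ) ^ 2)⁻¹ = CD d * ((n : ℝ) ^ 2)⁻¹ * 1 := (mul_one _).symm
        _ ≤ (Bc d * (64 * 7⁻¹) * CD d + KΔ d * (64 * 7⁻¹) ^ 2) * ((n : ℝ) ^ 2)⁻¹ * (1 + (W n l)⁻¹) :=
          mul_le_mul (mul_le_mul_of_nonneg_right h1 hu0) h2 zero_le_one (by positivity)
  unfold pairD
  by_cases hk : k = fun _ => 0
  · have hk' : k' ≠ fun _ => 0 := fun h => hkk ⟨hk, h⟩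
    rw [hk, iotaK_zero hnm, if_pos rfl, if_pos rfl, DeltaXi_shift_iotaK_eq_SW, DeltaXi_shift_eq_SW, one_div,
      one_div, wt_zero]
    exact single hk'
  · by_cases hk' : k' = fun _ => 0
    · rw [hk', iotaK_zero hnm, if_neg (iotaK_ne_zero hnm hk), if_pos rfl, if_neg hk, if_pos rfl,
        DeltaXi_shift_iotaK_eq_SW, DeltaXi_shift_eq_SW, one_div, one_div, wt_zero]
      refine (single hk).mono (le_of_eq (by ring)) (le_of_eq (by ring))
    · rw [if_neg (iotaK_ne_zero hnm hk), if_neg (iotaK_ne_zero hnm hk'), if_neg hk, if_neg hk',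
        DeltaXi_shift_iotaK_eq_SW, DeltaXi_shift_iotaK_eq_SW, DeltaXi_shift_eq_SW, DeltaXi_shift_eq_SW,
        wt_of_ne n k hk, wt_of_ne n k' hk', div_eq_mul_inv, div_eq_mul_inv, mul_inv, mul_inv]
      have h := (DeltaXi0_RB hn hnm hr hq).mul ((SWinv_RB hn hnm (rOf_le d) (d_mul_rOf_sq_le d) (strip_subset_fat (rOf_pos d).le (hκ.trans (kappa183_le_rOf d)) hp) hk).mul (SWinv_RB hn hnm (rOf_le d) (d_mul_rOf_sq_le d) (strip_subset_fat (rOf_pos d).le (hκ.trans (kappa183_le_rOf d)) hp) hk'))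
      have hW := one_le_W n k hk
      have hW' := one_le_W n k' hk'
      have hx0 : 0 ≤ (W n k)⁻¹ := by positivity
      have hy0 : 0 ≤ (W n k')⁻¹ := by positivity
      have hy1 : (W n k')⁻¹ ≤ 1 := inv_le_one_of_one_le₀ hW'
      have hxy : (W n k)⁻¹ * (W n k')⁻¹ ≤ (W n k)⁻¹ + (W n k')⁻¹ := by
        nlinarith [mul_le_of_le_one_right hx0 hy1]
      refine h.mono (le_of_eq ?_) ?_
      · unfold βP; simp only [div_eq_mul_inv]; ring
      · unfold κP; simp only [div_eq_mul_inv, one_mul]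
        nlinarith [mul_le_mul_of_nonneg_left hxy (by positivity : (0 : ℝ) ≤ KΔ d * ((n : ℝ) ^ 2)⁻¹ * (64 * 7⁻¹) ^ 2)]

omit hn hκ0 hκ hp in
/-- not-both-zero is preserved by the pairing. [folklore] -/
theorem not_both_zero_iotaK {k k' : Fin d → Fin n} (hkk : ¬ (k = (fun _ => 0) ∧ k' = (fun _ => 0))) :
    ¬ (iotaK n m hnm k = (fun _ => 0) ∧ iotaK n m hnm k' = (fun _ => 0)) := by
  rintro ⟨h1, h2⟩
  apply hkk
  constructor
  · by_contra hk; exact iotaK_ne_zero hnm hk h1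
  · by_contra hk'; exact iotaK_ne_zero hnm hk' h2

/-- **THE REGULAR `δ_{μν}`-TERM away from `l = l′ = 0`**:
`−ū(p′+l)v̄_μ(p′+l)·u(p′+l′)v_μ(p′+l′)·P(l,l′)/Y^G_μ` under the pairing — bound `βDg·bw(l)·bw(l′)`, rate
`κDg·n⁻¹·rw(l)·rw(l′)`. [folklore] -/
theorem diagReg_ne_RB (μ : Fin d) {k k' : Fin d → Fin n} (hkk : ¬ (k = (fun _ => 0) ∧ k' = (fun _ => 0))) :
    RB (diagReg m μ (iotaK n m hnm k) (iotaK n m hnm k') p) (diagReg n μ k k' p)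
      (βDg d * (bw n k * bw n k')) (κDg d * (((n : ℝ))⁻¹ * (rw n k * rw n k'))) := by
  have hq := (strip_subset_fat (rOf_pos d).le (hκ.trans (kappa183_le_rOf d)) hp)
  have hr := rOf_le d
  obtain ⟨-, -, hYm, -⟩ := denominators_lower m hκ0 hκ hp
  obtain ⟨-, -, hYn, -⟩ := denominators_lower n hκ0 hκ hp
  rw [diagReg_of_ne m μ (not_both_zero_iotaK hnm hkk), diagReg_of_ne n μ hkk]
  have h := ((uv_RB hn hnm hr hq k μ).mul (uvC_RB hn hnm hr hq k' μ)).mul (pairD_RB hn hnm hκ hp hkk)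
  have hd := RB_div (cY163_pos d) h (YG_RB hn hnm hκ hp μ) (hYm μ) (hYn μ)
  refine (RB_neg hd).mono (le_of_eq ?_) ?_
  · unfold βDg bw; simp only [div_eq_mul_inv]; ring
  -- the rate
  clear h hd
  have hP := Pom_pos n k; have hP' := Pom_pos n k'
  have hs1 := one_le_tw n k; have hs1' := one_le_tw n k'
  have hs0 := tw_pos n k; have hs0' := tw_pos n k'
  have hνd := inv_level_le_tw n k; have hνd' := inv_level_le_tw n k'
  have hn2 : (2 : ℝ) ≤ n := by exact_mod_cast hn
  have hν0 : 0 ≤ ((n : ℝ))⁻¹ := by positivity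
  have hν1 : ((n : ℝ))⁻¹ ≤ 1 := inv_le_one_of_one_le₀ (by linarith)
  have hu : ((n : ℝ) ^ 2)⁻¹ = ((n : ℝ))⁻¹ * ((n : ℝ))⁻¹ := by rw [sq, mul_inv]
  have hτ0 : 0 < (tw n k)⁻¹ := by positivity
  have hτ0' : 0 < (tw n k')⁻¹ := by positivity
  have hτ1 : (tw n k)⁻¹ ≤ 1 := inv_le_one_of_one_le₀ hs1
  have hτ1' : (tw n k')⁻¹ ≤ 1 := inv_le_one_of_one_le₀ hs1'
  have m2 : tw n k * ((tw n k)⁻¹ * (tw n k)⁻¹) = (tw n k)⁻¹ := by field_simp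
  have m2' : tw n k' * ((tw n k')⁻¹ * (tw n k')⁻¹) = (tw n k')⁻¹ := by field_simp
  have hd0 : (0 : ℝ) ≤ (d : ℝ) + 1 := by positivity
  have hcY := cY163_pos d
  have hβ := βP_nonneg d; have hκP := κP_nonneg d; have hKYG := KYG_nonneg d; have hCv := Cv_nonneg
  rw [wt_eq n k, wt_eq n k']
  unfold rw κDg
  simp only [div_eq_mul_inv, hu]
  generalize Pom n k = P at *
  generalize Pom n k' = P' at *
  generalize tw n k = s at *
  generalize tw n k' = s' at *
  generalize s⁻¹ = τ at *
  generalize s'⁻¹ = τ' at *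
  generalize ((n : ℝ))⁻¹ = ν at *
  -- monomial facts
  have m1 : ν * (τ * τ) ≤ ((d : ℝ) + 1) * τ' * τ := by
    calc ν * (τ * τ) ≤ (((d : ℝ) + 1) * τ') * (τ * 1) :=
          mul_le_mul hνd' (mul_le_mul_of_nonneg_left hτ1 hτ0.le) (by positivity) (by positivity)
      _ = ((d : ℝ) + 1) * τ' * τ := by ring
  have m1' : ν * (τ' * τ') ≤ ((d : ℝ) + 1) * τ * τ' := by
    calc ν * (τ' * τ') ≤ (((d : ℝ) + 1) * τ) * (τ' * 1) :=
          mul_le_mul hνd (mul_le_mul_of_nonneg_left hτ1' hτ0'.le) (by positivity) (by positivity)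
      _ = ((d : ℝ) + 1) * τ * τ' := by ring
  have m3 : τ * τ ≤ τ := mul_le_of_le_one_right hτ0.le hτ1
  have m3' : τ' * τ' ≤ τ' := mul_le_of_le_one_right hτ0'.le hτ1'
  have m4 : (τ * τ) * (s' * (τ' * τ')) ≤ τ * τ' := by rw [m2']; exact mul_le_mul_of_nonneg_right m3 hτ0'.le
  have m4' : (s * (τ * τ)) * (τ' * τ') ≤ τ * τ' := by rw [m2]; exact mul_le_mul_of_nonneg_left m3' hτ0.le
  have m5 : ν * ((τ * τ) * (τ' * τ')) ≤ τ * τ' := by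
    calc ν * ((τ * τ) * (τ' * τ')) ≤ 1 * (τ * τ') := mul_le_mul hν1 (mul_le_mul m3 m3' (by positivity) hτ0.le)
          (by positivity) zero_le_one
      _ = τ * τ' := one_mul _
  linarith [mul_le_mul_of_nonneg_left m1 (by positivity : (0 : ℝ) ≤ 144 * κP d * (cY163 d)⁻¹ * P * P' * ν),
    mul_le_mul_of_nonneg_left m1' (by positivity : (0 : ℝ) ≤ 144 * κP d * (cY163 d)⁻¹ * P * P' * ν),
    mul_le_mul_of_nonneg_left m4 (by positivity : (0 : ℝ) ≤ 12 * Cv * ((d : ℝ) + 1) * βP d * (cY163 d)⁻¹ * P * P' * ν),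
    mul_le_mul_of_nonneg_left m4' (by positivity : (0 : ℝ) ≤ 12 * Cv * ((d : ℝ) + 1) * βP d * (cY163 d)⁻¹ * P * P' * ν),
    mul_le_mul_of_nonneg_left m5 (by positivity : (0 : ℝ) ≤ 144 * βP d * KYG d * (cY163 d ^ 2)⁻¹ * P * P' * ν)]

/-- **THE REGULAR `δ_{μν}`-TERM at `l = l′ = 0`**: `R^G_μ/Y^G_μ` — bound `2B_c/c_Y`, rate `κDg0/n²`. [folklore] -/
theorem diagReg_zero_RB (μ : Fin d) :
    RB (diagReg m μ (fun _ => 0) (fun _ => 0) p) (diagReg n μ (fun _ => 0) (fun _ => 0) p)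
      (2 * Bc d / cY163 d) (κDg0 d / (n : ℝ) ^ 2) := by
  obtain ⟨-, -, hYm, -⟩ := denominators_lower m hκ0 hκ hp
  obtain ⟨-, -, hYn, -⟩ := denominators_lower n hκ0 hκ hp
  rw [diagReg_zero, diagReg_zero]
  have h := RB_div (cY163_pos d) (RG_RB hn hnm hκ hp μ) (YG_RB hn hnm hκ hp μ) (hYm μ) (hYn μ)
  refine h.mono le_rfl (le_of_eq ?_)
  unfold κDg0; simp only [div_eq_mul_inv]; ring

end DecayPkg


/-! ### §3.2 The square brackets `B₁(l,μ)`, `B₂(l′,ν)` -/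

/-- `x·(N·x^{N−1}) = N·x^N` (also at `N = 0`). [folklore] -/
theorem mul_pow_pred (x : ℝ) (N : ℕ) : x * (N * x ^ (N - 1)) = N * x ^ N := by
  rcases N with _ | N
  · simp
  · rw [Nat.add_sub_cancel, pow_succ]; ring

/-- `B₁(l,μ)`, `l ≠ 0`, in INVERSE FORM: with `D = Δ(p′+l)`,
`B₁ = Π_{ν≠μ}v̄_ν·(∂_μ v̄_μ)·Δ(p′)·(D⁻¹D⁻¹𝒩⁻¹) − (ū v̄_μ)·∂_{1,μ}·((Y^G_μ)⁻¹D⁻¹)`. [folklore] -/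
theorem B1_ne_eq (N : ℕ) [NeZero N] (μ : Fin d) {K : Fin d → Fin N} (hK : K ≠ fun _ => 0) (p : Fin d → ℂ) :
    B1 N μ K p = (∏ ν ∈ univ.erase μ, vCbar N K p ν) * (dC N K p μ * vCbar N K p μ) * DeltaXi N 0 p
        * ((DeltaXi N 0 (shift N K p))⁻¹ * (DeltaXi N 0 (shift N K p))⁻¹ * (Ncal N p)⁻¹)
      - uCbar N K p * vCbar N K p μ * expFacPos μ p * ((YG N μ p)⁻¹ * (DeltaXi N 0 (shift N K p))⁻¹) := by
  unfold B1; rw [if_neg hK]; unfold uCbar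
  rw [← Finset.mul_prod_erase univ (fun ν => vCbar N K p ν) (Finset.mem_univ μ)]
  simp only [div_eq_mul_inv, mul_inv, sq]; ring

/-- `B₁(0,μ)` regrouped: `(Π_{ν≠μ}v̄_ν·(∂_μv̄_μ)·R^G_μ − (ūv̄_μ)·∂_{1,μ}·Δ(p′)·X_{≠0})/(𝒩·Y^G_μ)`. [folklore] -/
theorem B1_zero_eq (N : ℕ) [NeZero N] (μ : Fin d) (p : Fin d → ℂ) :
    B1 N μ (fun _ => 0) p = ((∏ ν ∈ univ.erase μ, vCbar N (fun _ => 0) p ν)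
        * (dC N (fun _ => 0) p μ * vCbar N (fun _ => 0) p μ) * RG N μ p
        - uCbar N (fun _ => 0) p * vCbar N (fun _ => 0) p μ * expFacPos μ p * (DeltaXi N 0 p * Xne N p))
        / (Ncal N p * YG N μ p) := by
  unfold B1; rw [if_pos rfl]; unfold uCbar
  rw [← Finset.mul_prod_erase univ (fun ν => vCbar N (fun _ => 0) p ν) (Finset.mem_univ μ)]
  ring

/-- `B₂(l′,ν)`, `l′ ≠ 0`, in inverse form (mirror of `B1_ne_eq`). [folklore] -/
theorem B2_ne_eq (N : ℕ) [NeZero N] (ν : Fin d) {K : Fin d → Fin N} (hK : K ≠ fun _ => 0) (p : Fin d → ℂ) :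
    B2 N ν K p = (∏ ν' ∈ univ.erase ν, vC N K p ν') * (dCbar N K p ν * vC N K p ν) * DeltaXi N 0 p
        * ((DeltaXi N 0 (shift N K p))⁻¹ * (DeltaXi N 0 (shift N K p))⁻¹ * (Ncal N p)⁻¹)
      - uC N K p * vC N K p ν * expFacNeg ν p * ((YG N ν p)⁻¹ * (DeltaXi N 0 (shift N K p))⁻¹) := by
  unfold B2; rw [if_neg hK]; unfold uC
  rw [← Finset.mul_prod_erase univ (fun ν' => vC N K p ν') (Finset.mem_univ ν)]
  simp only [div_eq_mul_inv, mul_inv, sq]; ring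

/-- `B₂(0,ν)` regrouped (mirror of `B1_zero_eq`). [folklore] -/
theorem B2_zero_eq (N : ℕ) [NeZero N] (ν : Fin d) (p : Fin d → ℂ) :
    B2 N ν (fun _ => 0) p = ((∏ ν' ∈ univ.erase ν, vC N (fun _ => 0) p ν')
        * (dCbar N (fun _ => 0) p ν * vC N (fun _ => 0) p ν) * RG N ν p
        - uC N (fun _ => 0) p * vC N (fun _ => 0) p ν * expFacNeg ν p * (DeltaXi N 0 p * Xne N p))
        / (Ncal N p * YG N ν p) := by
  unfold B2; rw [if_pos rfl]; unfold uC
  rw [← Finset.mul_prod_erase univ (fun ν' => vC N (fun _ => 0) p ν') (Finset.mem_univ ν)]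
  ring

/-- bound constant of the brackets away from the zero alias. [folklore] -/
def βBn (d : ℕ) : ℝ := Bc d * (64 / 7) ^ 2 / 3 / cN163 d + 48 * (64 / 7) / cY163 d

/-- rate constant of the brackets away from the zero alias. [folklore] -/
def κBn (d : ℕ) : ℝ :=
  Bc d * (64 / 7) ^ 2 * KNcal d / 3 / cN163 d ^ 2 + 2 * Bc d * (64 / 7) * CD d / 3 / cN163 d
    + KΔ d * (64 / 7) ^ 2 / 3 / cN163 d + Cp * Bc d * (64 / 7) ^ 2 / 12 / cN163 d
    + Cv * Bc d * (64 / 7) ^ 2 * d / 36 / cN163 d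
    + 48 * CD d * ((d : ℝ) + 1) / cY163 d + 48 * KYG d * (64 / 7) / cY163 d ^ 2
    + 4 * Cv * ((d : ℝ) + 1) * (64 / 7) / cY163 d

/-- bound constant of the brackets at the zero alias. [folklore] -/
def βB0 (d : ℕ) : ℝ := (12 ^ d * 4 * (2 * Bc d) + 12 * 12 ^ d * 4 * (Bc d * (132 ^ d / 4))) / (cN163 d * cY163 d)

/-- rate constant of the brackets at the zero alias. [folklore] -/
def κB0 (d : ℕ) : ℝ :=
  (12 ^ d * 4 * KR d + (12 ^ d * Cp + Cv * d * 12 ^ d * 4) * (2 * Bc d)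
      + (12 * 12 ^ d * 4 * (Bc d * KX d + KΔ d * (132 ^ d / 4))
        + Cv * ((d : ℝ) + 1) * 12 ^ d * 4 * (Bc d * (132 ^ d / 4)))) / (cN163 d * cY163 d)
    + (12 ^ d * 4 * (2 * Bc d) + 12 * 12 ^ d * 4 * (Bc d * (132 ^ d / 4))) * (BN d * KYG d + KNcal d * (3 * Bc d ^ 2))
      / (cN163 d * cY163 d) ^ 2

/-- Nonnegativity of the constant / profile (bookkeeping). [folklore] -/
theorem βBn_nonneg (d : ℕ) : 0 ≤ βBn d := by
  unfold βBn; have := Bc_pos d; have := cN163_pos d; have := cY163_pos d; positivity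
/-- Nonnegativity of the constant / profile (bookkeeping). [folklore] -/
theorem κBn_nonneg (d : ℕ) : 0 ≤ κBn d := by
  unfold κBn
  have := Bc_pos d; have := cN163_pos d; have := cY163_pos d; have := KNcal_nonneg d; have := CD_nonneg d
  have := KΔ_nonneg d; have := Cp_nonneg; have := Cv_nonneg; have := KYG_nonneg d
  positivity
/-- Nonnegativity of the constant / profile (bookkeeping). [folklore] -/
theorem βB0_nonneg (d : ℕ) : 0 ≤ βB0 d := by
  unfold βB0; have := Bc_pos d; have := cN163_pos d; have := cY163_pos d; positivity
/-- Nonnegativity of the constant / profile (bookkeeping). [folklore] -/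
theorem κB0_nonneg (d : ℕ) : 0 ≤ κB0 d := by
  unfold κB0 BN
  have := Bc_pos d; have := cN163_pos d; have := cY163_pos d; have := KNcal_nonneg d; have := KR_nonneg d
  have := KΔ_nonneg d; have := Cp_nonneg; have := Cv_nonneg; have := KYG_nonneg d; have := KX_nonneg d
  positivity

section Brackets

variable {n m : ℕ} [NeZero n] [NeZero m] (hn : 2 ≤ n) (hnm : n ≤ m) {κ : ℝ} (hκ0 : 0 ≤ κ)
  (hκ : κ ≤ kappa183 d) {p : Fin d → ℂ} (hp : p ∈ Strip d κ)
include hn hnm hκ0 hκ hp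

/-- **THE GENERIC BRACKET AWAY FROM THE ZERO ALIAS.** Fed with the packages of `Π_{ν≠μ}v̄` (`hPE`), `∂_μ·v̄_μ`
(`hDV`), `ū·v̄_μ` (`hAV`) — or their conjugate-leaf mirrors — and `|∂_{1,·}| ≤ 4`, the inverse form of the
bracket has bound `βBn·bw(l)` and rate `κBn·n⁻¹·rw(l)`: every `n⁻²` of a scalar rate is traded
`n⁻¹ ≤ (d+1)·tw(l)⁻¹`, every `ω_μ` against a `tw(l)⁻¹`. [folklore] -/
theorem bracketNe_RB {k : Fin d → Fin n} (hk : k ≠ fun _ => 0) (μ lam : Fin d) {PE₁ PE₂ DV₁ DV₂ AV₁ AV₂ e : ℂ}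
    (hPE : RB PE₁ PE₂ (omega n (k μ) / 12 * Pom n k)
      (Cv / n * (omega n (k μ) / 12 * Pom n k) * ∑ ν, (12 / omega n (k ν))⁻¹))
    (hDV : RB DV₁ DV₂ 4 (Cp * omega n (k μ) / n))
    (hAV : RB AV₁ AV₂ (12 * Pom n k) (Cv * ((d : ℝ) + 1) * (((n : ℝ))⁻¹ * (Pom n k * tw n k))))
    (he : ‖e‖ ≤ 4) :
    RB (PE₁ * DV₁ * DeltaXi m 0 p * ((SW m n k p)⁻¹ * (SW m n k p)⁻¹ * (Ncal m p)⁻¹)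
          - AV₁ * e * ((YG m lam p)⁻¹ * (SW m n k p)⁻¹))
       (PE₂ * DV₂ * DeltaXi n 0 p * ((SW n n k p)⁻¹ * (SW n n k p)⁻¹ * (Ncal n p)⁻¹)
          - AV₂ * e * ((YG n lam p)⁻¹ * (SW n n k p)⁻¹))
       (βBn d * bw n k) (κBn d * (((n : ℝ))⁻¹ * rw n k)) := by
  have hq := (strip_subset_fat (rOf_pos d).le (hκ.trans (kappa183_le_rOf d)) hp)
  have hr := rOf_le d
  have T1 := ((hPE.mul hDV).mul (DeltaXi0_RB hn hnm hr hq)).mul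
    (((SWinv_RB hn hnm (rOf_le d) (d_mul_rOf_sq_le d) (strip_subset_fat (rOf_pos d).le (hκ.trans (kappa183_le_rOf d)) hp) hk).mul (SWinv_RB hn hnm (rOf_le d) (d_mul_rOf_sq_le d) (strip_subset_fat (rOf_pos d).le (hκ.trans (kappa183_le_rOf d)) hp) hk)).mul (Ninv_RB hn hnm hκ0 hκ hp))
  have T2 := (hAV.mul (RB.of_eq e he)).mul ((YGinv_RB hn hnm hκ0 hκ hp lam).mul (SWinv_RB hn hnm (rOf_le d) (d_mul_rOf_sq_le d) (strip_subset_fat (rOf_pos d).le (hκ.trans (kappa183_le_rOf d)) hp) hk))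
  have h := RB_sub T1 T2
  clear T1 T2
  -- facts about the profiles
  have hP := Pom_pos n k
  have hω1 := one_le_omega n _ (k μ).isLt
  have hs1 := one_le_tw n k
  have hs0 := tw_pos n k
  have hωs : omega n (k μ) ≤ tw n k := omega_le_tw n k μ
  have hSg := sum_inv_c_le_tw n k
  have hSg0 : 0 ≤ ∑ ν, (12 / omega n (k ν))⁻¹ :=
    Finset.sum_nonneg (fun ν _ => by have := omega_pos n (k ν) (k ν).isLt; positivity)
  have hνd := inv_level_le_tw n k
  have hn2 : (2 : ℝ) ≤ n := by exact_mod_cast hn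
  have hν0 : 0 ≤ ((n : ℝ))⁻¹ := by positivity
  have hν1 : ((n : ℝ))⁻¹ ≤ 1 := inv_le_one_of_one_le₀ (by linarith)
  have hu : ((n : ℝ) ^ 2)⁻¹ = ((n : ℝ))⁻¹ * ((n : ℝ))⁻¹ := by rw [sq, mul_inv]
  have hWi : (W n k)⁻¹ = (tw n k)⁻¹ * (tw n k)⁻¹ := by rw [← one_div, ← wt_of_ne n k hk, wt_eq]
  have hτ0 : 0 < (tw n k)⁻¹ := by positivity
  have hτ1 : (tw n k)⁻¹ ≤ 1 := inv_le_one_of_one_le₀ hs1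
  have hωτ : omega n (k μ) * (tw n k)⁻¹ ≤ 1 := by
    rw [← div_eq_mul_inv]; exact (div_le_one hs0).mpr hωs
  have hsτ : tw n k * (tw n k)⁻¹ = 1 := mul_inv_cancel₀ hs0.ne'
  have hBc := Bc_pos d; have hcN := cN163_pos d; have hcY := cY163_pos d; have hKN := KNcal_nonneg d
  have hCD := CD_nonneg d; have hKΔ := KΔ_nonneg d; have hCp := Cp_nonneg; have hCv := Cv_nonneg
  have hKYG := KYG_nonneg d
  have hd0 : (0 : ℝ) ≤ d := Nat.cast_nonneg d
  refine h.mono ?_ ?_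
  · -- the bound
    clear h
    rw [bw_of_ne n hk]
    unfold βBn
    simp only [div_eq_mul_inv, hWi, one_mul]
    generalize Pom n k = P at *
    generalize omega n (k μ) = ω at *
    generalize tw n k = s at *
    generalize s⁻¹ = τ at *
    have f : ω * (τ * τ) ≤ 1 :=
      (mul_le_mul_of_nonneg_left (mul_le_of_le_one_right hτ0.le hτ1) (by linarith)).trans hωτ
    linarith [mul_le_mul_of_nonneg_left f
      (by positivity : (0 : ℝ) ≤ Bc d * (64 * 7⁻¹) ^ 2 * 3⁻¹ * (cN163 d)⁻¹ * P * (τ * τ))]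
  · -- the rate
    clear h
    generalize (∑ ν, (12 / omega n (k ν))⁻¹) = Sg at *
    unfold rw κBn
    simp only [div_eq_mul_inv, hu, hWi, one_mul, mul_zero, zero_add]
    generalize Pom n k = P at *
    generalize omega n (k μ) = ω at *
    generalize tw n k = s at *
    generalize s⁻¹ = τ at *
    generalize ((n : ℝ))⁻¹ = ν at *
    -- monomial facts
    have hω0 : 0 ≤ ω := by linarith
    have hττ : τ * τ ≤ 1 := mul_le_one₀ hτ1 hτ0.le hτ1
    have fb : ν * (ω * τ) ≤ 1 := mul_le_one₀ hν1 (by positivity) hωτ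
    have fa : ν * (ω * τ) * (τ * τ) ≤ 1 := by
      calc ν * (ω * τ) * (τ * τ) ≤ 1 * 1 := mul_le_mul fb hττ (by positivity) zero_le_one
        _ = 1 := one_mul 1
    have fd : (ω * τ) * (ω * τ) * τ ≤ 1 := by
      have h1 : (ω * τ) * (ω * τ) ≤ 1 := mul_le_one₀ hωτ (by positivity) hωτ
      calc (ω * τ) * (ω * τ) * τ ≤ 1 * 1 := mul_le_mul h1 hτ1 hτ0.le zero_le_one
        _ = 1 := one_mul 1
    have fe : ω * Sg * (τ * τ * τ) ≤ d * 12⁻¹ := by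
      have h1 : ω * Sg * (τ * τ * τ) ≤ ω * (d * s * 12⁻¹) * (τ * τ * τ) := by
        have : Sg ≤ d * s * 12⁻¹ := by simpa [div_eq_mul_inv] using hSg
        exact mul_le_mul_of_nonneg_right (mul_le_mul_of_nonneg_left this (by linarith)) (by positivity)
      have h2 : ω * (d * s * 12⁻¹) * (τ * τ * τ) = d * 12⁻¹ * ((ω * τ) * (s * τ) * τ) := by ring
      rw [h2, hsτ, mul_one] at h1
      have h3 : (ω * τ) * τ ≤ 1 := by
        calc (ω * τ) * τ ≤ 1 * 1 := mul_le_mul hωτ hτ1 hτ0.le zero_le_one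
          _ = 1 := one_mul 1
      calc ω * Sg * (τ * τ * τ) ≤ d * 12⁻¹ * ((ω * τ) * τ) := h1
        _ ≤ d * 12⁻¹ * 1 := mul_le_mul_of_nonneg_left h3 (by positivity)
        _ = d * 12⁻¹ := mul_one _
    have fg : ν * τ ≤ 1 := mul_le_one₀ hν1 hτ0.le hτ1
    have ha := mul_le_mul_of_nonneg_left fa
      (by positivity : (0 : ℝ) ≤ Bc d * (64 * 7⁻¹) ^ 2 * KNcal d * 3⁻¹ * (cN163 d ^ 2)⁻¹ * (ν * (P * τ)))
    have hb := mul_le_mul_of_nonneg_left fb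
      (by positivity : (0 : ℝ) ≤ 2 * Bc d * (64 * 7⁻¹) * CD d * 3⁻¹ * (cN163 d)⁻¹ * (ν * (P * τ)))
    have hc := mul_le_mul_of_nonneg_left fa
      (by positivity : (0 : ℝ) ≤ KΔ d * (64 * 7⁻¹) ^ 2 * 3⁻¹ * (cN163 d)⁻¹ * (ν * (P * τ)))
    have hd := mul_le_mul_of_nonneg_left fd
      (by positivity : (0 : ℝ) ≤ Cp * Bc d * (64 * 7⁻¹) ^ 2 * 12⁻¹ * (cN163 d)⁻¹ * (ν * (P * τ)))
    have he' := mul_le_mul_of_nonneg_left fe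
      (by positivity : (0 : ℝ) ≤ Cv * Bc d * (64 * 7⁻¹) ^ 2 * 3⁻¹ * (cN163 d)⁻¹ * (ν * (P * τ)))
    have hf := mul_le_mul_of_nonneg_left hνd
      (by positivity : (0 : ℝ) ≤ 48 * CD d * (cY163 d)⁻¹ * (ν * P))
    have hg := mul_le_mul_of_nonneg_left fg
      (by positivity : (0 : ℝ) ≤ 48 * KYG d * (64 * 7⁻¹) * (cY163 d ^ 2)⁻¹ * (ν * (P * τ)))
    have hh : 4 * Cv * ((d : ℝ) + 1) * (64 * 7⁻¹) * (cY163 d)⁻¹ * (ν * (P * τ)) * (s * τ)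
        = 4 * Cv * ((d : ℝ) + 1) * (64 * 7⁻¹) * (cY163 d)⁻¹ * (ν * (P * τ)) := by rw [hsτ, mul_one]
    linarith [ha, hb, hc, hd, he', hf, hg, hh]

/-- **THE GENERIC BRACKET AT THE ZERO ALIAS**: bound `βB0`, rate `κB0·n⁻¹`. [folklore] -/
theorem bracketZero_RB (lam : Fin d) {PE₁ PE₂ DV₁ DV₂ AV₁ AV₂ e : ℂ}
    (hPE : RB PE₁ PE₂ (12 ^ d) (Cv * d * 12 ^ d * ((n : ℝ))⁻¹))
    (hDV : RB DV₁ DV₂ 4 (Cp * ((n : ℝ))⁻¹))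
    (hAV : RB AV₁ AV₂ (12 * 12 ^ d) (Cv * ((d : ℝ) + 1) * 12 ^ d * ((n : ℝ))⁻¹))
    (he : ‖e‖ ≤ 4) :
    RB ((PE₁ * DV₁ * RG m lam p - AV₁ * e * (DeltaXi m 0 p * Xne m p)) / (Ncal m p * YG m lam p))
       ((PE₂ * DV₂ * RG n lam p - AV₂ * e * (DeltaXi n 0 p * Xne n p)) / (Ncal n p * YG n lam p))
       (βB0 d) (κB0 d * ((n : ℝ))⁻¹) := by
  have hq := (strip_subset_fat (rOf_pos d).le (hκ.trans (kappa183_le_rOf d)) hp)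
  have hr := rOf_le d
  have hdr := d_mul_rOf_sq_le d
  have hn1 : 1 ≤ n := by omega
  obtain ⟨-, hNm, hYm, -⟩ := denominators_lower m hκ0 hκ hp
  obtain ⟨-, hNn, hYn, -⟩ := denominators_lower n hκ0 hκ hp
  have RG' := (RG_RB hn hnm hκ hp lam).mono le_rfl (div_sq_le_mul_inv (KR_nonneg d) hn1)
  have D0' := (DeltaXi0_RB hn hnm hr hq).mono le_rfl (div_sq_le_mul_inv (KΔ_nonneg d) hn1)
  have X' := (Xne_RB hn hnm hr hdr hq).mono le_rfl (div_sq_le_mul_inv (KX_nonneg d) hn1)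
  have N' := (Ncal_RB hn hnm hr hdr hq).mono le_rfl (div_sq_le_mul_inv (KNcal_nonneg d) hn1)
  have Y' := (YG_RB hn hnm hκ hp lam).mono le_rfl (div_sq_le_mul_inv (KYG_nonneg d) hn1)
  have num := RB_sub ((hPE.mul hDV).mul RG') ((hAV.mul (RB.of_eq e he)).mul (D0'.mul X'))
  have den := N'.mul Y'
  have hc : 0 < cN163 d * cY163 d := mul_pos (cN163_pos d) (cY163_pos d)
  have hlo : ∀ (M : ℕ) [NeZero M], cN163 d ≤ ‖Ncal M p‖ → (∀ l, cY163 d ≤ ‖YG M l p‖) →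
      cN163 d * cY163 d ≤ ‖Ncal M p * YG M lam p‖ := by
    intro M _ hN hY
    rw [norm_mul]; exact mul_le_mul hN (hY lam) (cY163_pos d).le (norm_nonneg _)
  have h := RB_div hc num den (hlo m hNm hYm) (hlo n hNn hYn)
  refine h.mono (le_of_eq ?_) (le_of_eq ?_)
  · unfold βB0; rfl
  · unfold κB0; simp only [div_eq_mul_inv]; ring

end Brackets


/-! ### §3.3 The leaves at the zero alias (`ω = tw = 1`, `Pom = 12^d`) -/

section ZeroLeaves

variable {n m : ℕ} [NeZero n] [NeZero m] (hn : 2 ≤ n) (hnm : n ≤ m) {r : ℝ} (hr : r ≤ 1 / 4)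
  {p : Fin d → ℂ} (hp : p ∈ Fat d r)
include hn hnm hr hp

/-- Zero-alias leaf package (the `l = 0` companion of the §1/§2 leaf packages). [folklore] -/
theorem prodErase0_RB (μ : Fin d) :
    RB (∏ ν ∈ univ.erase μ, vCbar m (fun _ => 0) p ν) (∏ ν ∈ univ.erase μ, vCbar n (fun _ => 0) p ν)
      (12 ^ d) (Cv * d * 12 ^ d * ((n : ℝ))⁻¹) := by
  have hn1 : 1 ≤ n := by omega
  have h := prodErase_RB hn hnm hr hp (fun _ => 0) μ
  rw [iotaK_zero hnm] at h
  have h12 : (0 : ℝ) < 12 ^ d := by positivity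
  have hX : 0 ≤ Cv * d * 12 ^ d * ((n : ℝ))⁻¹ := by have := Cv_nonneg; positivity
  refine h.mono ?_ ?_
  · simp only [Fin.val_zero, omega_zero n hn1, Pom_zero]; linarith
  · simp only [Fin.val_zero, omega_zero n hn1, Pom_zero, div_one, Finset.sum_const, Finset.card_univ,
      Fintype.card_fin, nsmul_eq_mul]
    simp only [div_eq_mul_inv, one_mul]
    nlinarith [hX]

/-- Zero-alias leaf package (the `l = 0` companion of the §1/§2 leaf packages). [folklore] -/
theorem prodEraseC0_RB (μ : Fin d) :
    RB (∏ ν ∈ univ.erase μ, vC m (fun _ => 0) p ν) (∏ ν ∈ univ.erase μ, vC n (fun _ => 0) p ν)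
      (12 ^ d) (Cv * d * 12 ^ d * ((n : ℝ))⁻¹) := by
  have hn1 : 1 ≤ n := by omega
  have h := prodEraseC_RB hn hnm hr hp (fun _ => 0) μ
  rw [iotaK_zero hnm] at h
  have h12 : (0 : ℝ) < 12 ^ d := by positivity
  have hX : 0 ≤ Cv * d * 12 ^ d * ((n : ℝ))⁻¹ := by have := Cv_nonneg; positivity
  refine h.mono ?_ ?_
  · simp only [Fin.val_zero, omega_zero n hn1, Pom_zero]; linarith
  · simp only [Fin.val_zero, omega_zero n hn1, Pom_zero, div_one, Finset.sum_const, Finset.card_univ,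
      Fintype.card_fin, nsmul_eq_mul]
    simp only [div_eq_mul_inv, one_mul]
    nlinarith [hX]

/-- Zero-alias leaf package (the `l = 0` companion of the §1/§2 leaf packages). [folklore] -/
theorem dC_mul_vCbar0_RB (μ : Fin d) :
    RB (dC m (fun _ => 0) p μ * vCbar m (fun _ => 0) p μ) (dC n (fun _ => 0) p μ * vCbar n (fun _ => 0) p μ)
      4 (Cp * ((n : ℝ))⁻¹) := by
  have hn1 : 1 ≤ n := by omega
  have h := dC_mul_vCbar_RB hn hnm hr hp (fun _ => 0) μ
  rw [iotaK_zero hnm] at h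
  refine h.mono le_rfl (le_of_eq ?_)
  simp only [Fin.val_zero, omega_zero n hn1]; ring

/-- Zero-alias leaf package (the `l = 0` companion of the §1/§2 leaf packages). [folklore] -/
theorem dCbar_mul_vC0_RB (μ : Fin d) :
    RB (dCbar m (fun _ => 0) p μ * vC m (fun _ => 0) p μ) (dCbar n (fun _ => 0) p μ * vC n (fun _ => 0) p μ)
      4 (Cp * ((n : ℝ))⁻¹) := by
  have hn1 : 1 ≤ n := by omega
  have h := dCbar_mul_vC_RB hn hnm hr hp (fun _ => 0) μ
  rw [iotaK_zero hnm] at h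
  refine h.mono le_rfl (le_of_eq ?_)
  simp only [Fin.val_zero, omega_zero n hn1]; ring

/-- Zero-alias leaf package (the `l = 0` companion of the §1/§2 leaf packages). [folklore] -/
theorem uv0_RB (μ : Fin d) :
    RB (uCbar m (fun _ => 0) p * vCbar m (fun _ => 0) p μ) (uCbar n (fun _ => 0) p * vCbar n (fun _ => 0) p μ)
      (12 * 12 ^ d) (Cv * ((d : ℝ) + 1) * 12 ^ d * ((n : ℝ))⁻¹) := by
  have h := uv_RB hn hnm hr hp (fun _ => 0) μ
  rw [iotaK_zero hnm] at h
  refine h.mono (le_of_eq ?_) (le_of_eq ?_)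
  · rw [Pom_zero]
  · rw [Pom_zero, tw_zero]; ring

/-- Zero-alias leaf package (the `l = 0` companion of the §1/§2 leaf packages). [folklore] -/
theorem uvC0_RB (μ : Fin d) :
    RB (uC m (fun _ => 0) p * vC m (fun _ => 0) p μ) (uC n (fun _ => 0) p * vC n (fun _ => 0) p μ)
      (12 * 12 ^ d) (Cv * ((d : ℝ) + 1) * 12 ^ d * ((n : ℝ))⁻¹) := by
  have h := uvC_RB hn hnm hr hp (fun _ => 0) μ
  rw [iotaK_zero hnm] at h
  refine h.mono (le_of_eq ?_) (le_of_eq ?_)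
  · rw [Pom_zero]
  · rw [Pom_zero, tw_zero]; ring

end ZeroLeaves

/-! ### §3.4 The packages of `B₁`, `B₂`, `midG·B₁·B₂`, the `δ_{μν}`-term and the diagonal correction -/

/-- bound constant of the brackets, all aliases. [folklore] -/
def βB1 (d : ℕ) : ℝ := βBn d + βB0 d
/-- rate constant of the brackets, all aliases. [folklore] -/
def κB1 (d : ℕ) : ℝ := κBn d + κB0 d
/-- bound constant of `midG·B₁·B₂`. [folklore] -/
def βMB (d : ℕ) : ℝ := Mmid183 d * βB1 d ^ 2
/-- rate constant of `midG·B₁·B₂`. [folklore] -/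
def κMB (d : ℕ) : ℝ := 2 * Mmid183 d * βB1 d * κB1 d + Kmid d * βB1 d ^ 2
/-- bound constant of the `δ_{μν}`-term, all aliases. [folklore] -/
def βD (d : ℕ) : ℝ := βDg d + 2 * Bc d / cY163 d
/-- rate constant of the `δ_{μν}`-term, all aliases. [folklore] -/
def κD (d : ℕ) : ℝ := κDg d + κDg0 d
/-- bound constant of the regular part `g^{reg}`. [folklore] -/
def βG (d : ℕ) : ℝ := βD d + βMB d
/-- rate constant of the regular part `g^{reg}`. [folklore] -/
def κG (d : ℕ) : ℝ := κD d + κMB d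

/-- Nonnegativity of the constant / profile (bookkeeping). [folklore] -/
theorem βB1_nonneg (d : ℕ) : 0 ≤ βB1 d := add_nonneg (βBn_nonneg d) (βB0_nonneg d)
/-- Nonnegativity of the constant / profile (bookkeeping). [folklore] -/
theorem κB1_nonneg (d : ℕ) : 0 ≤ κB1 d := add_nonneg (κBn_nonneg d) (κB0_nonneg d)
/-- Nonnegativity of the constant / profile (bookkeeping). [folklore] -/
theorem βMB_nonneg (d : ℕ) : 0 ≤ βMB d := by
  unfold βMB; have := B5G183Strip.Mmid183_nonneg d; have := βB1_nonneg d; positivity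
/-- Nonnegativity of the constant / profile (bookkeeping). [folklore] -/
theorem κMB_nonneg (d : ℕ) : 0 ≤ κMB d := by
  unfold κMB; have := B5G183Strip.Mmid183_nonneg d; have := βB1_nonneg d; have := κB1_nonneg d
  have := Kmid_nonneg d; positivity
/-- Nonnegativity of the constant / profile (bookkeeping). [folklore] -/
theorem βD_nonneg (d : ℕ) : 0 ≤ βD d := by
  unfold βD; have := βDg_nonneg d; have := Bc_pos d; have := cY163_pos d; positivity
/-- Nonnegativity of the constant / profile (bookkeeping). [folklore] -/
theorem κD_nonneg (d : ℕ) : 0 ≤ κD d := add_nonneg (κDg_nonneg d) (κDg0_nonneg d)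
/-- Nonnegativity of the constant / profile (bookkeeping). [folklore] -/
theorem βG_nonneg (d : ℕ) : 0 ≤ βG d := add_nonneg (βD_nonneg d) (βMB_nonneg d)
/-- Nonnegativity of the constant / profile (bookkeeping). [folklore] -/
theorem κG_nonneg (d : ℕ) : 0 ≤ κG d := add_nonneg (κD_nonneg d) (κMB_nonneg d)

/-- the zero package. [folklore] -/
theorem RB_zero {B ρ : ℝ} (hB : 0 ≤ B) (hρ : 0 ≤ ρ) : RB (0 : ℂ) 0 B ρ :=
  ⟨by simpa using hB, by simpa using hB, by simpa using hρ⟩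

/-- majorant of the diagonal correction at alias `l` (bound side). [folklore] -/
def corrB (n : ℕ) [NeZero n] (N : ℕ) (k : Fin d → Fin n) : ℝ :=
  if k = fun _ => 0 then N * (64 / 39) ^ N else (64 / 7) ^ (N + 1) * ((W n k)⁻¹) ^ (N + 1)

/-- majorant of the diagonal correction at alias `l` (rate side, without the factor `n⁻²`). [folklore] -/
def corrR (n : ℕ) [NeZero n] (N : ℕ) (k : Fin d → Fin n) : ℝ :=
  if k = fun _ => 0 then Kres d N else (N + 1) * (64 / 7) ^ N * CD d * ((W n k)⁻¹) ^ N

/-- Nonnegativity of the constant / profile (bookkeeping). [folklore] -/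
theorem corrB_nonneg (n : ℕ) [NeZero n] (N : ℕ) (k : Fin d → Fin n) : 0 ≤ corrB n N k := by
  unfold corrB; split_ifs with hk
  · positivity
  · have := one_le_W n k hk; positivity

/-- Nonnegativity of the constant / profile (bookkeeping). [folklore] -/
theorem corrR_nonneg (n : ℕ) [NeZero n] (N : ℕ) (k : Fin d → Fin n) : 0 ≤ corrR n N k := by
  unfold corrR; split_ifs with hk
  · exact Kres_nonneg d N
  · have := one_le_W n k hk; have := CD_nonneg d; positivity

section Combine

variable {n m : ℕ} [NeZero n] [NeZero m] (hn : 2 ≤ n) (hnm : n ≤ m) {κ : ℝ} (hκ0 : 0 ≤ κ)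
  (hκ : κ ≤ kappa183 d) {p : Fin d → ℂ} (hp : p ∈ Strip d κ)
include hn hnm hκ0 hκ hp

omit hn hnm hκ0 in
/-- `κ ≤ 1` on the admissible widths. [folklore] -/
theorem kappa_le_one : κ ≤ 1 := by
  have := strip_subset_fat (rOf_pos d).le (hκ.trans (kappa183_le_rOf d)) hp
  exact hκ.trans ((kappa183_le_rOf d).trans ((rOf_le d).trans (by norm_num)))

/-- **THE PACKAGE OF `B₁(l,μ)`**, every alias: bound `βB1·bw(l)`, rate `κB1·n⁻¹·rw(l)`. [folklore] -/
theorem B1_RB (μ : Fin d) (k : Fin d → Fin n) :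
    RB (B1 m μ (iotaK n m hnm k) p) (B1 n μ k p) (βB1 d * bw n k) (κB1 d * (((n : ℝ))⁻¹ * rw n k)) := by
  have hq := (strip_subset_fat (rOf_pos d).le (hκ.trans (kappa183_le_rOf d)) hp)
  have hr := rOf_le d
  have he := (norm_expFac_le_four (kappa_le_one hκ hp) hp μ).2
  have hν0 : 0 ≤ ((n : ℝ))⁻¹ := by positivity
  have hβn := βBn_nonneg d; have hβ0 := βB0_nonneg d; have hκn := κBn_nonneg d; have hκ0' := κB0_nonneg d
  by_cases hk : k = fun _ => 0
  · subst hk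
    rw [iotaK_zero hnm, B1_zero_eq, B1_zero_eq, bw_zero, rw_zero]
    have h := bracketZero_RB hn hnm hκ0 hκ hp μ (prodErase0_RB hn hnm hr hq μ) (dC_mul_vCbar0_RB hn hnm hr hq μ)
      (uv0_RB hn hnm hr hq μ) he
    have h12 : (1 : ℝ) ≤ 12 ^ d := one_le_pow₀ (by norm_num)
    refine h.mono ?_ ?_
    · unfold βB1; nlinarith [mul_le_mul_of_nonneg_left h12 (add_nonneg hβn hβ0)]
    · unfold κB1
      nlinarith [mul_le_mul_of_nonneg_left h12 (mul_nonneg (add_nonneg hκn hκ0') hν0), mul_nonneg hκn hν0]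
  · rw [B1_ne_eq m μ (iotaK_ne_zero hnm hk), B1_ne_eq n μ hk, DeltaXi_shift_iotaK_eq_SW, DeltaXi_shift_eq_SW]
    have h := bracketNe_RB hn hnm hκ0 hκ hp hk μ μ (prodErase_RB hn hnm hr hq k μ)
      (dC_mul_vCbar_RB hn hnm hr hq k μ) (uv_RB hn hnm hr hq k μ) he
    have hb := bw_pos n k; have hrw := rw_pos n k
    refine h.mono ?_ ?_
    · unfold βB1; nlinarith [mul_nonneg hβ0 hb.le]
    · unfold κB1; nlinarith [mul_nonneg hκ0' (mul_nonneg hν0 hrw.le)]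

/-- **THE PACKAGE OF `B₂(l′,ν)`**, every alias (conjugate leaves). [folklore] -/
theorem B2_RB (ν : Fin d) (k : Fin d → Fin n) :
    RB (B2 m ν (iotaK n m hnm k) p) (B2 n ν k p) (βB1 d * bw n k) (κB1 d * (((n : ℝ))⁻¹ * rw n k)) := by
  have hq := (strip_subset_fat (rOf_pos d).le (hκ.trans (kappa183_le_rOf d)) hp)
  have hr := rOf_le d
  have he := (norm_expFac_le_four (kappa_le_one hκ hp) hp ν).1
  have hν0 : 0 ≤ ((n : ℝ))⁻¹ := by positivity
  have hβn := βBn_nonneg d; have hβ0 := βB0_nonneg d; have hκn := κBn_nonneg d; have hκ0' := κB0_nonneg d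
  by_cases hk : k = fun _ => 0
  · subst hk
    rw [iotaK_zero hnm, B2_zero_eq, B2_zero_eq, bw_zero, rw_zero]
    have h := bracketZero_RB hn hnm hκ0 hκ hp ν (prodEraseC0_RB hn hnm hr hq ν) (dCbar_mul_vC0_RB hn hnm hr hq ν)
      (uvC0_RB hn hnm hr hq ν) he
    have h12 : (1 : ℝ) ≤ 12 ^ d := one_le_pow₀ (by norm_num)
    refine h.mono ?_ ?_
    · unfold βB1; nlinarith [mul_le_mul_of_nonneg_left h12 (add_nonneg hβn hβ0)]
    · unfold κB1
      nlinarith [mul_le_mul_of_nonneg_left h12 (mul_nonneg (add_nonneg hκn hκ0') hν0), mul_nonneg hκn hν0]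
  · rw [B2_ne_eq m ν (iotaK_ne_zero hnm hk), B2_ne_eq n ν hk, DeltaXi_shift_iotaK_eq_SW, DeltaXi_shift_eq_SW]
    have h := bracketNe_RB hn hnm hκ0 hκ hp hk ν ν (prodEraseC_RB hn hnm hr hq k ν)
      (dCbar_mul_vC_RB hn hnm hr hq k ν) (uvC_RB hn hnm hr hq k ν) he
    have hb := bw_pos n k; have hrw := rw_pos n k
    refine h.mono ?_ ?_
    · unfold βB1; nlinarith [mul_nonneg hβ0 hb.le]
    · unfold κB1; nlinarith [mul_nonneg hκ0' (mul_nonneg hν0 hrw.le)]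

/-- **THE PACKAGE OF `midG·B₁(l,μ)·B₂(l′,ν)`**: bound `βMB·bw(l)bw(l′)`, rate `κMB·n⁻¹·rw(l)rw(l′)`. [folklore] -/
theorem midB_RB (μ ν : Fin d) (k k' : Fin d → Fin n) :
    RB (midG m p * B1 m μ (iotaK n m hnm k) p * B2 m ν (iotaK n m hnm k') p)
       (midG n p * B1 n μ k p * B2 n ν k' p)
       (βMB d * (bw n k * bw n k')) (κMB d * (((n : ℝ))⁻¹ * (rw n k * rw n k'))) := by
  have hn1 : 1 ≤ n := by omega
  have hmid := (midG_RB hn hnm hκ0 hκ hp).mono le_rfl (div_sq_le_mul_inv (Kmid_nonneg d) hn1)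
  have h := (hmid.mul (B1_RB hn hnm hκ0 hκ hp μ k)).mul (B2_RB hn hnm hκ0 hκ hp ν k')
  have hb := bw_le_rw n k; have hb' := bw_le_rw n k'
  have h0 := (bw_pos n k).le; have h0' := (bw_pos n k').le
  have r0 := (rw_pos n k).le; have r0' := (rw_pos n k').le
  have hν0 : 0 ≤ ((n : ℝ))⁻¹ := by positivity
  have hM := B5G183Strip.Mmid183_nonneg d; have hβ := βB1_nonneg d; have hκ' := κB1_nonneg d
  have hKm := Kmid_nonneg d
  refine h.mono (le_of_eq (by unfold βMB; ring)) ?_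
  unfold κMB
  have i1 : bw n k * rw n k' ≤ rw n k * rw n k' := mul_le_mul_of_nonneg_right hb r0'
  have i2 : rw n k * bw n k' ≤ rw n k * rw n k' := mul_le_mul_of_nonneg_left hb' r0
  have i3 : bw n k * bw n k' ≤ rw n k * rw n k' := mul_le_mul hb hb' h0' r0
  nlinarith [mul_le_mul_of_nonneg_left i1 (by positivity : (0 : ℝ) ≤ Mmid183 d * βB1 d * κB1 d * ((n : ℝ))⁻¹),
    mul_le_mul_of_nonneg_left i2 (by positivity : (0 : ℝ) ≤ Mmid183 d * βB1 d * κB1 d * ((n : ℝ))⁻¹),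
    mul_le_mul_of_nonneg_left i3 (by positivity : (0 : ℝ) ≤ Kmid d * βB1 d ^ 2 * ((n : ℝ))⁻¹)]

/-- the `δ_{μν}`-term `A(l,l′;μ) − δ_{ll′}/Δ(p′+l)` (= `diagReg`), every alias pair. [folklore] -/
theorem diagRegAll_RB (μ : Fin d) (k k' : Fin d → Fin n) :
    RB (diagReg m μ (iotaK n m hnm k) (iotaK n m hnm k') p) (diagReg n μ k k' p)
      (βD d * (bw n k * bw n k')) (κD d * (((n : ℝ))⁻¹ * (rw n k * rw n k'))) := by
  have hn1 : 1 ≤ n := by omega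
  have hν0 : 0 ≤ ((n : ℝ))⁻¹ := by positivity
  have hβ := βDg_nonneg d; have hκ1 := κDg_nonneg d; have hκ2 := κDg0_nonneg d
  have hBc := Bc_pos d; have hcY := cY163_pos d
  have h2 : 0 ≤ 2 * Bc d / cY163 d := by positivity
  by_cases hkk : k = (fun _ => 0) ∧ k' = (fun _ => 0)
  · obtain ⟨rfl, rfl⟩ := hkk
    rw [iotaK_zero hnm, bw_zero, rw_zero]
    have h := diagReg_zero_RB hn hnm hκ0 hκ hp μ
    have h12 : (1 : ℝ) ≤ 12 ^ d := one_le_pow₀ (by norm_num)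
    have h144 : (1 : ℝ) ≤ 12 ^ d * 12 ^ d := one_le_mul_of_one_le_of_one_le h12 h12
    have hr := div_sq_le_mul_inv (κDg0_nonneg d) hn1
    refine h.mono ?_ (hr.trans ?_)
    · unfold βD; nlinarith [mul_le_mul_of_nonneg_left h144 (add_nonneg hβ h2)]
    · unfold κD
      nlinarith [mul_le_mul_of_nonneg_left h144 (mul_nonneg (add_nonneg hκ1 hκ2) hν0), mul_nonneg hκ1 hν0]
  · have h := diagReg_ne_RB hn hnm hκ0 hκ hp μ hkk
    have hb : 0 ≤ bw n k * bw n k' := mul_nonneg (bw_pos n k).le (bw_pos n k').le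
    have hrw : 0 ≤ rw n k * rw n k' := mul_nonneg (rw_pos n k).le (rw_pos n k').le
    refine h.mono ?_ ?_
    · unfold βD; nlinarith [mul_nonneg h2 hb]
    · unfold κD; nlinarith [mul_nonneg hκ2 (mul_nonneg hν0 hrw)]

/-- the `δ_{μν}`-term with its Kronecker delta. [folklore] -/
theorem diagTerm_RB (μ ν : Fin d) (k k' : Fin d → Fin n) :
    RB (if μ = ν then diagReg m μ (iotaK n m hnm k) (iotaK n m hnm k') p else 0)
       (if μ = ν then diagReg n μ k k' p else 0)
       (βD d * (bw n k * bw n k')) (κD d * (((n : ℝ))⁻¹ * (rw n k * rw n k'))) := by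
  split_ifs with h
  · exact diagRegAll_RB hn hnm hκ0 hκ hp μ k k'
  · have := βD_nonneg d; have := κD_nonneg d; have := bw_pos n k; have := bw_pos n k'
    have := rw_pos n k; have := rw_pos n k'
    exact RB_zero (by positivity) (by positivity)

/-- **THE DIAGONAL CORRECTION** `δ_{μν}δ_{ll′}((1 − δ_{l0})/Δ(p′+l) − R_N(Δ(p′+l)))` under the pairing:
for `l ≠ 0` it equals `Δ(p′+l)⁻¹(Δ(p′+l)+1)^{−N}` (bound `(64/7)^{N+1}W^{−N−1}`, rate `(N+1)(64/7)^N·CD·W^{−N}/n²`),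
for `l = 0` it is `−R_N(Δ(p′))` (bound `N(64/39)^N`, rate `Kres/n²`). [folklore] -/
theorem corr_RB (N : ℕ) (μ ν : Fin d) (k k' : Fin d → Fin n) :
    RB (freeDiag m μ ν (iotaK n m hnm k) (iotaK n m hnm k') p - freeN m N μ ν (iotaK n m hnm k) (iotaK n m hnm k') p)
       (freeDiag n μ ν k k' p - freeN n N μ ν k k' p)
       (if μ = ν ∧ k = k' then corrB n N k else 0)
       ((if μ = ν ∧ k = k' then corrR n N k else 0) / (n : ℝ) ^ 2) := by
  have hq := (strip_subset_fat (rOf_pos d).le (hκ.trans (kappa183_le_rOf d)) hp)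
  have hr := rOf_le d
  have hdr := d_mul_rOf_sq_le d
  rw [freeDiag_sub_freeN, freeDiag_sub_freeN]
  by_cases hc : μ = ν ∧ k = k'
  · obtain ⟨hμν, rfl⟩ := hc
    subst hμν
    simp only [and_self, ↓reduceIte]
    by_cases hk : k = fun _ => 0
    · subst hk
      rw [iotaK_zero hnm, if_neg (not_not.mpr rfl), if_neg (not_not.mpr rfl), shift_zero, shift_zero,
        zero_sub, zero_sub]
      unfold corrB corrR
      rw [if_pos rfl, if_pos rfl]
      exact RB_neg (resolv_RB hn hnm hκ hp N)
    · rw [if_pos (iotaK_ne_zero hnm hk), if_pos hk, DeltaXi_shift_iotaK_eq_SW, DeltaXi_shift_eq_SW]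
      have hz : ∀ {z : ℂ}, 2 ≤ ‖z‖ → 1 ≤ ‖z + 1‖ → 1 / z - resolv N z = z⁻¹ * ((z + 1)⁻¹) ^ N := by
        intro z h2 h1
        have hz0 : z ≠ 0 := by intro h; rw [h, norm_zero] at h2; linarith
        have hz1 : z + 1 ≠ 0 := by intro h; rw [h, norm_zero] at h1; linarith
        rw [inv_sub_resolv hz0 hz1, one_div, mul_inv, inv_pow]
      obtain ⟨-, -, -, hDm⟩ := denominators_lower m hκ0 hκ hp
      obtain ⟨-, -, -, hDn⟩ := denominators_lower n hκ0 hκ hp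
      have hm2 := hDm (iotaK n m hnm k) (iotaK_ne_zero hnm hk)
      rw [DeltaXi_shift_iotaK_eq_SW] at hm2
      have hn2 := hDn k hk
      rw [DeltaXi_shift_eq_SW] at hn2
      have hW0 : 0 ≤ W n k := by have := one_le_W n k hk; linarith
      have hm1 : 1 ≤ ‖SW m n k p + 1‖ := by
        have h := norm_DeltaXi_shift_add_one_ge m hr hdr hq (iotaK n m hnm k) (iotaK_ne_zero hnm hk)
        rw [DeltaXi_shift_iotaK_eq_SW] at h
        have := W_le_W_iotaK hnm k
        nlinarith
      have hn1 : 1 ≤ ‖SW n n k p + 1‖ := by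
        have h := norm_DeltaXi_shift_add_one_ge n hr hdr hq k hk
        rw [DeltaXi_shift_eq_SW] at h
        nlinarith
      rw [hz hm2 hm1, hz hn2 hn1]
      unfold corrB corrR
      rw [if_neg hk, if_neg hk]
      have h := (SWinv_RB hn hnm (rOf_le d) (d_mul_rOf_sq_le d) (strip_subset_fat (rOf_pos d).le (hκ.trans (kappa183_le_rOf d)) hp) hk).mul (RB_pow' (SW1i_RB hn hnm hκ hp hk) N)
      refine h.mono (le_of_eq ?_) (le_of_eq ?_)
      · simp only [div_eq_mul_inv, mul_pow]; ring
      · calc 64 / 7 / W n k * (N * (64 / 7 / W n k) ^ (N - 1) * (CD d / (n : ℝ) ^ 2))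
              + CD d / (n : ℝ) ^ 2 * (64 / 7 / W n k) ^ N
            = (64 / 7 / W n k * (N * (64 / 7 / W n k) ^ (N - 1))) * (CD d / (n : ℝ) ^ 2)
              + CD d / (n : ℝ) ^ 2 * (64 / 7 / W n k) ^ N := by ring
          _ = N * (64 / 7 / W n k) ^ N * (CD d / (n : ℝ) ^ 2) + CD d / (n : ℝ) ^ 2 * (64 / 7 / W n k) ^ N := by
              rw [mul_pow_pred]
          _ = (N + 1) * (64 / 7) ^ N * CD d * ((W n k)⁻¹) ^ N / (n : ℝ) ^ 2 := by
              simp only [div_eq_mul_inv, mul_pow]; ring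
  · have hc' : ¬ (μ = ν ∧ iotaK n m hnm k = iotaK n m hnm k') := fun h => hc ⟨h.1, iotaK_injective hnm h.2⟩
    rw [if_neg hc', if_neg hc, if_neg hc, if_neg hc, zero_div]
    exact RB_zero le_rfl le_rfl

/-- **THE PACKAGE OF THE COVARIANT REGULAR PART** `g^{cov,N}_{μν}(l,l′;p′)` under the pairing:
bound `βG·bw(l)bw(l′) + δδ·corrB(l)`, rate `κG·n⁻¹·rw(l)rw(l′) + δδ·corrR(l)/n²`. [folklore] -/
theorem gcov_RB (N : ℕ) (μ ν : Fin d) (k k' : Fin d → Fin n) :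
    RB (g183cov m N μ ν (iotaK n m hnm k) (iotaK n m hnm k') p) (g183cov n N μ ν k k' p)
       (βG d * (bw n k * bw n k') + (if μ = ν ∧ k = k' then corrB n N k else 0))
       (κG d * (((n : ℝ))⁻¹ * (rw n k * rw n k'))
          + (if μ = ν ∧ k = k' then corrR n N k else 0) / (n : ℝ) ^ 2) := by
  rw [g183cov_eq, g183cov_eq, g183reg_eq, g183reg_eq]
  have h := ((diagTerm_RB hn hnm hκ0 hκ hp μ ν k k').add (midB_RB hn hnm hκ0 hκ hp μ ν k k')).add
    (corr_RB hn hnm hκ0 hκ hp N μ ν k k')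
  exact h.mono (le_of_eq (by unfold βG; ring)) (le_of_eq (by unfold κG; ring))

end Combine



/-! ## §4 The paired / unpaired split and the η-rate of the continued covariant regular part `Mcov` -/

/-- `Σ_l corrB(l) ≤ CB` (`N ≥ d`). [folklore] -/
def CB (d N : ℕ) : ℝ := N * (64 / 39) ^ N + (64 / 7) ^ (N + 1) * (2 * zetaC 2) ^ d
/-- `Σ_l corrR(l) ≤ CR` (`N ≥ d`). [folklore] -/
def CR (d N : ℕ) : ℝ := Kres d N + (N + 1) * (64 / 7) ^ N * CD d * (2 * zetaC 2) ^ d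
/-- the unpaired majorant of the correction: `corrB_m(L) ≤ (2/n)·corrU_m(L)` at an unpaired `L`. [folklore] -/
def corrU (n : ℕ) [NeZero n] (N : ℕ) (k : Fin d → Fin n) : ℝ :=
  if k = fun _ => 0 then 0 else (64 / 7) ^ (N + 1) * ((W n k)⁻¹) ^ N
/-- `Σ_L corrU(L) ≤ CU` (`N ≥ d`). [folklore] -/
def CU (d N : ℕ) : ℝ := (64 / 7) ^ (N + 1) * (2 * zetaC 2) ^ d

/-- Nonnegativity of the constant / profile (bookkeeping). [folklore] -/
theorem CB_nonneg (d N : ℕ) : 0 ≤ CB d N := by unfold CB; have := zetaC_nonneg 2; positivity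
/-- Nonnegativity of the constant / profile (bookkeeping). [folklore] -/
theorem CR_nonneg (d N : ℕ) : 0 ≤ CR d N := by
  unfold CR; have := zetaC_nonneg 2; have := Kres_nonneg d N; have := CD_nonneg d; positivity
/-- Nonnegativity of the constant / profile (bookkeeping). [folklore] -/
theorem CU_nonneg (d N : ℕ) : 0 ≤ CU d N := by unfold CU; have := zetaC_nonneg 2; positivity
/-- Nonnegativity of the constant / profile (bookkeeping). [folklore] -/
theorem corrU_nonneg (n : ℕ) [NeZero n] (N : ℕ) (k : Fin d → Fin n) : 0 ≤ corrU n N k := by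
  unfold corrU; split_ifs with hk
  · exact le_rfl
  · have := one_le_W n k hk; positivity

/-- `W⁻ᴹ ≤ Π_ν ω_ν⁻²` for `l ≠ 0`, `M ≥ d`. [folklore] -/
theorem pow_inv_W_le_prod (n : ℕ) [NeZero n] (k : Fin d → Fin n) (hk : k ≠ fun _ => 0) {M : ℕ} (hM : d ≤ M) :
    ((W n k)⁻¹) ^ M ≤ ∏ ν, (omega n (k ν) ^ 2)⁻¹ := by
  rw [inv_pow, ← one_div]; exact inv_W_pow_le_prod n k hk hM

/-- `W^{−(M+1)} ≤ W^{−M}` for `l ≠ 0`. [folklore] -/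
theorem pow_inv_W_succ_le (n : ℕ) [NeZero n] (k : Fin d → Fin n) (hk : k ≠ fun _ => 0) (M : ℕ) :
    ((W n k)⁻¹) ^ (M + 1) ≤ ((W n k)⁻¹) ^ M := by
  have h1 := one_le_W n k hk
  have hx0 : 0 ≤ (W n k)⁻¹ := by positivity
  have hx1 : (W n k)⁻¹ ≤ 1 := inv_le_one_of_one_le₀ h1
  rw [pow_succ]; exact mul_le_of_le_one_right (pow_nonneg hx0 M) hx1

/-- a sum over the alias box split at the zero alias, the rest majorised by `Π_ν ω_ν⁻²`. [folklore] -/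
theorem sum_alias_le (n : ℕ) [NeZero n] (f : (Fin d → Fin n) → ℝ) {c0 c1 : ℝ} (hc1 : 0 ≤ c1)
    (h0 : f (fun _ => 0) ≤ c0) (h1 : ∀ k, k ≠ (fun _ => 0) → f k ≤ c1 * ∏ ν, (omega n (k ν) ^ 2)⁻¹) :
    ∑ k, f k ≤ c0 + c1 * (2 * zetaC 2) ^ d := by
  classical
  rw [← Finset.add_sum_erase _ _ (Finset.mem_univ (fun _ : Fin d => (0 : Fin n)))]
  have step1 : ∑ k ∈ univ.erase (fun _ : Fin d => (0 : Fin n)), f k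
      ≤ ∑ k ∈ univ.erase (fun _ : Fin d => (0 : Fin n)), c1 * ∏ ν, (omega n (k ν) ^ 2)⁻¹ :=
    Finset.sum_le_sum (fun k hk => h1 k (Finset.ne_of_mem_erase hk))
  have step2 : ∑ k ∈ univ.erase (fun _ : Fin d => (0 : Fin n)), c1 * ∏ ν, (omega n (k ν) ^ 2)⁻¹
      ≤ ∑ k : Fin d → Fin n, c1 * ∏ ν, (omega n (k ν) ^ 2)⁻¹ := by
    apply Finset.sum_le_sum_of_subset_of_nonneg (Finset.erase_subset _ _)
    intro k _ _
    positivity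
  have step3 : ∑ k : Fin d → Fin n, c1 * ∏ ν, (omega n (k ν) ^ 2)⁻¹ ≤ c1 * (2 * zetaC 2) ^ d := by
    rw [← Finset.mul_sum]; exact mul_le_mul_of_nonneg_left (sum_prod_inv_sq_le n) hc1
  linarith

/-- Alias-sum bound for the diagonal correction profile (bookkeeping over `B5G183CovSplit.sum_prod_inv_sq_le`). [folklore] -/
theorem sum_corrB_le (n : ℕ) [NeZero n] {N : ℕ} (hN : d ≤ N) : ∑ k : Fin d → Fin n, corrB n N k ≤ CB d N := by
  refine sum_alias_le n (corrB n N) (by positivity) (le_of_eq (by unfold corrB; rw [if_pos rfl])) (fun k hk => ?_)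
  unfold corrB; rw [if_neg hk]
  exact mul_le_mul_of_nonneg_left ((pow_inv_W_succ_le n k hk N).trans (pow_inv_W_le_prod n k hk hN))
    (by positivity)

/-- Alias-sum bound for the diagonal correction profile (bookkeeping over `B5G183CovSplit.sum_prod_inv_sq_le`). [folklore] -/
theorem sum_corrR_le (n : ℕ) [NeZero n] {N : ℕ} (hN : d ≤ N) : ∑ k : Fin d → Fin n, corrR n N k ≤ CR d N := by
  have := CD_nonneg d
  refine sum_alias_le n (corrR n N) (by positivity) (le_of_eq (by unfold corrR; rw [if_pos rfl])) (fun k hk => ?_)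
  unfold corrR; rw [if_neg hk]
  exact mul_le_mul_of_nonneg_left (pow_inv_W_le_prod n k hk hN) (by positivity)

/-- Alias-sum bound for the diagonal correction profile (bookkeeping over `B5G183CovSplit.sum_prod_inv_sq_le`). [folklore] -/
theorem sum_corrU_le (n : ℕ) [NeZero n] {N : ℕ} (hN : d ≤ N) : ∑ k : Fin d → Fin n, corrU n N k ≤ CU d N := by
  have h := sum_alias_le n (corrU n N) (c0 := 0) (c1 := (64 / 7) ^ (N + 1)) (by positivity)
    (le_of_eq (by unfold corrU; rw [if_pos rfl])) (fun k hk => by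
      unfold corrU; rw [if_neg hk]
      exact mul_le_mul_of_nonneg_left (pow_inv_W_le_prod n k hk hN) (by positivity))
  unfold CU; linarith

/-- **THE UNPAIRED GAIN of the correction**: `corrB_m(L) ≤ (2/n)·corrU_m(L)` at an unpaired alias. [folklore] -/
theorem corrB_unpaired_le {n m : ℕ} [NeZero m] (hn : 1 ≤ n) {K : Fin d → Fin m}
    (hP : ¬ ∀ ν, Paired n m (K ν)) (N : ℕ) : corrB m N K ≤ 2 / n * corrU m N K := by
  have hK : K ≠ fun _ => 0 := by
    rintro rfl
    exact hP (fun ν => by simpa using paired_zero (m := m) hn)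
  unfold corrB corrU; rw [if_neg hK, if_neg hK]
  have hs1 := one_le_sqrtW m hK
  have hx : (W m K)⁻¹ ≤ 2 / n := by
    refine (inv_W_unpaired_le hn hK hP).trans ?_
    have : (Real.sqrt (W m K))⁻¹ ≤ 1 := inv_le_one_of_one_le₀ hs1
    have h2 : (0 : ℝ) ≤ 2 / n := by positivity
    nlinarith
  have h1 := one_le_W m K hK
  have hc : 0 ≤ (64 / 7 : ℝ) ^ (N + 1) * ((W m K)⁻¹) ^ N := by positivity
  have := mul_le_mul_of_nonneg_left hx hc
  rw [pow_succ (W m K)⁻¹ N]; nlinarith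

/-- an inner Kronecker sum. [folklore] -/
theorem sum_ite_and_eq_le {α : Type*} [Fintype α] [DecidableEq α] (Q : Prop) [Decidable Q] (k : α) {c : ℝ}
    (hc : 0 ≤ c) : ∑ k' : α, (if Q ∧ k = k' then c else 0) ≤ c := by
  by_cases hQ : Q
  · simp only [hQ, true_and, Finset.sum_ite_eq, Finset.mem_univ, if_true]; exact le_rfl
  · simp only [hQ, false_and, if_false, Finset.sum_const_zero]; exact hc

/-- the split of a double sum into its `P × P` block and the rest. [folklore] -/
theorem sum_sum_split {α : Type*} (s : Finset α) (P : α → Prop) [DecidablePred P] (F : α → α → ℂ) :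
    ∑ K ∈ s, ∑ K' ∈ s, F K K'
      = (∑ K ∈ s.filter P, ∑ K' ∈ s.filter P, F K K')
        + ∑ K ∈ s, ∑ K' ∈ s, (if P K ∧ P K' then 0 else F K K') := by
  rw [Finset.sum_filter]
  have e1 : ∀ K ∈ s, (if P K then ∑ K' ∈ s.filter P, F K K' else 0)
      = ∑ K' ∈ s, (if P K ∧ P K' then F K K' else 0) := by
    intro K _
    rw [Finset.sum_filter]
    split_ifs with hK
    · exact Finset.sum_congr rfl (fun K' _ => by by_cases hK' : P K' <;> simp [hK, hK'])
    · symm; exact Finset.sum_eq_zero (fun K' _ => by simp [hK])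
  rw [Finset.sum_congr rfl e1, ← Finset.sum_add_distrib]
  refine Finset.sum_congr rfl (fun K _ => ?_)
  rw [← Finset.sum_add_distrib]
  exact Finset.sum_congr rfl (fun K' _ => by split_ifs <;> simp)

/-- the constant of the two-level rate (`n ≥ 2`). [folklore] -/
def C183two (d N : ℕ) : ℝ := κG d * Crw d ^ 2 + CR d N + 2 * (βG d * Crw d ^ 2 + CU d N)

/-- Nonnegativity of the constant / profile (bookkeeping). [folklore] -/
theorem C183two_nonneg (d N : ℕ) : 0 ≤ C183two d N := by
  unfold C183two; have := κG_nonneg d; have := βG_nonneg d; have := Crw_nonneg d; have := CR_nonneg d N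
  have := CU_nonneg d N; positivity

/-- **THE η-RATE CONSTANT** `C183 d N` of the continued covariant regular part (all `n ≥ 1`). [folklore] -/
def C183 (d N : ℕ) : ℝ := C183two d N + 2 * Mcov183 d N

/-- Nonnegativity of the constant / profile (bookkeeping). [folklore] -/
theorem C183_nonneg (d N : ℕ) : 0 ≤ C183 d N := by
  unfold C183; have := C183two_nonneg d N; have := Mcov183_nonneg d N; positivity

/-- Comparison of the constants (bookkeeping). [folklore] -/
theorem C183two_le_C183 (d N : ℕ) : C183two d N ≤ C183 d N := by
  unfold C183; have := Mcov183_nonneg d N; linarith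

section Rate

variable {n m : ℕ} [NeZero n] [NeZero m] (hn : 2 ≤ n) (hnm : n ≤ m) {κ : ℝ} (hκ0 : 0 ≤ κ)
  (hκ : κ ≤ kappa183 d) {p : Fin d → ℂ} (hp : p ∈ Strip d κ)
include hn hnm hκ0 hκ hp

omit [NeZero n] in
/-- an UNPAIRED term of the fine double sum is `O(1/n)` with a summable profile. [folklore] -/
theorem unpaired_term_le (N : ℕ) (μ ν : Fin d) (a' b' : Fin d → Fin m) (K K' : Fin d → Fin m)
    (hPP : ¬ ((∀ ν, Paired n m (K ν)) ∧ ∀ ν, Paired n m (K' ν))) :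
    ‖phase163 m K a' p * g183cov m N μ ν K K' p * phaseNeg m K' b' p‖
      ≤ Real.exp κ ^ d * Real.exp κ ^ d
          * (2 / n * (βG d * (rw m K * rw m K') + (if K = K' then corrU m N K else 0))) := by
  have hn1 : 1 ≤ n := by omega
  have hm2 : 2 ≤ m := hn.trans hnm
  have hE0 : 0 ≤ Real.exp κ ^ d := by positivity
  have hg := (gcov_RB hm2 le_rfl hκ0 hκ hp N μ ν K K').right
  have h1 := norm_phase163_le m hp K a'
  have h2 := norm_phaseNeg_le m hp K' b'
  have hβ := βG_nonneg d
  have r0 := (rw_pos m K).le; have r0' := (rw_pos m K').le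
  have b0 := (bw_pos m K).le; have b0' := (bw_pos m K').le
  have hν2 : (0 : ℝ) ≤ 2 / n := by positivity
  have key : βG d * (bw m K * bw m K') + (if μ = ν ∧ K = K' then corrB m N K else 0)
      ≤ 2 / n * (βG d * (rw m K * rw m K') + (if K = K' then corrU m N K else 0)) := by
    have i2 : (if μ = ν ∧ K = K' then corrB m N K else 0) ≤ 2 / n * (if K = K' then corrU m N K else 0) := by
      split_ifs with hc hKK
      · obtain ⟨-, rfl⟩ := hc
        have hK : ¬ ∀ ν, Paired n m (K ν) := fun h => hPP ⟨h, h⟩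
        exact corrB_unpaired_le hn1 hK N
      · exact absurd hc.2 hKK
      · have := corrU_nonneg m N K; positivity
      · simp
    have i1 : bw m K * bw m K' ≤ 2 / n * (rw m K * rw m K') := by
      rcases not_and_or.mp hPP with hK | hK'
      · calc bw m K * bw m K' ≤ (2 / n * rw m K) * rw m K' :=
              mul_le_mul (bw_unpaired_le hn1 hK) (bw_le_rw m K') b0' (by positivity)
          _ = 2 / n * (rw m K * rw m K') := by ring
      · calc bw m K * bw m K' ≤ rw m K * (2 / n * rw m K') :=
              mul_le_mul (bw_le_rw m K) (bw_unpaired_le hn1 hK') b0' r0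
          _ = 2 / n * (rw m K * rw m K') := by ring
    nlinarith [mul_le_mul_of_nonneg_left i1 hβ]
  have hI : 0 ≤ βG d * (bw m K * bw m K') + (if μ = ν ∧ K = K' then corrB m N K else 0) := by
    have : 0 ≤ (if μ = ν ∧ K = K' then corrB m N K else 0) := by
      split_ifs
      · exact corrB_nonneg m N K
      · exact le_rfl
    positivity
  rw [norm_mul, norm_mul]
  have hF : ‖phase163 m K a' p‖ * ‖g183cov m N μ ν K K' p‖ * ‖phaseNeg m K' b' p‖
      ≤ Real.exp κ ^ d * (βG d * (bw m K * bw m K') + (if μ = ν ∧ K = K' then corrB m N K else 0))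
          * Real.exp κ ^ d :=
    mul_le_mul (mul_le_mul h1 hg (norm_nonneg _) hE0) h2 (norm_nonneg _) (mul_nonneg hE0 hI)
  refine hF.trans ?_
  have := mul_le_mul_of_nonneg_left key (mul_nonneg hE0 hE0)
  nlinarith

/-- **THE η-RATE OF THE CONTINUED COVARIANT REGULAR PART, two levels `n ≤ m`, `n ≥ 2`.**  Under the physical
coarse-point conditions `a′·n = a·m`, `b′·n = b·m`, for `p′ ∈ Strip κ`, `κ ≤ κ₁₈₃`, `N ≥ d`:
`‖Mcov_m(p′) − Mcov_n(p′)‖ ≤ e^{κd}e^{κd}·C183two/n`. [folklore] -/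
theorem Mcov_rate_two {N : ℕ} (hN : d ≤ N) (μ ν : Fin d) (a b : Fin d → Fin n) (a' b' : Fin d → Fin m)
    (ha : ∀ ν, (a' ν : ℕ) * n = (a ν : ℕ) * m) (hb : ∀ ν, (b' ν : ℕ) * n = (b ν : ℕ) * m) :
    ‖Mcov m N μ ν a' b' p - Mcov n N μ ν a b p‖ ≤ Real.exp κ ^ d * Real.exp κ ^ d * C183two d N / n := by
  classical
  have hn1 : 1 ≤ n := by omega
  have hm2 : 2 ≤ m := hn.trans hnm
  have hE0 : 0 ≤ Real.exp κ ^ d := by positivity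
  have hν0 : 0 ≤ ((n : ℝ))⁻¹ := by positivity
  have hn0 : (0 : ℝ) < n := by positivity
  -- the split of the fine double sum into the paired block and the unpaired rest
  have hsplit := sum_sum_split (univ : Finset (Fin d → Fin m)) (fun K => ∀ ν, Paired n m (K ν))
    (fun K K' => phase163 m K a' p * g183cov m N μ ν K K' p * phaseNeg m K' b' p)
  rw [filter_paired_univ hnm, Finset.sum_image (fun k₁ _ k₂ _ h => iotaK_injective hnm h)] at hsplit
  have hin : ∀ k : Fin d → Fin n,
      ∑ K' ∈ univ.image (iotaK n m hnm),
          phase163 m (iotaK n m hnm k) a' p * g183cov m N μ ν (iotaK n m hnm k) K' p * phaseNeg m K' b' p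
        = ∑ k', phase163 m (iotaK n m hnm k) a' p * g183cov m N μ ν (iotaK n m hnm k) (iotaK n m hnm k') p
            * phaseNeg m (iotaK n m hnm k') b' p :=
    fun k => Finset.sum_image (fun k₁ _ k₂ _ h => iotaK_injective hnm h)
  rw [Finset.sum_congr rfl (fun k _ => hin k)] at hsplit
  simp_rw [phase163_iotaK_eq hnm _ a a' ha p, phaseNeg_iotaK_eq hnm _ b b' hb p] at hsplit
  have hMm : Mcov m N μ ν a' b' p
      = (∑ k : Fin d → Fin n, ∑ k' : Fin d → Fin n,
            phase163 n k a p * g183cov m N μ ν (iotaK n m hnm k) (iotaK n m hnm k') p * phaseNeg n k' b p)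
        + ∑ K, ∑ K', (if (∀ ν, Paired n m (K ν)) ∧ (∀ ν, Paired n m (K' ν)) then 0
            else phase163 m K a' p * g183cov m N μ ν K K' p * phaseNeg m K' b' p) := by
    unfold Mcov; exact hsplit
  have hMn : Mcov n N μ ν a b p = ∑ k, ∑ k', phase163 n k a p * g183cov n N μ ν k k' p * phaseNeg n k' b p := rfl
  -- the paired block minus the coarse sum
  have hdiff : (∑ k : Fin d → Fin n, ∑ k' : Fin d → Fin n,
        phase163 n k a p * g183cov m N μ ν (iotaK n m hnm k) (iotaK n m hnm k') p * phaseNeg n k' b p)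
      - (∑ k, ∑ k', phase163 n k a p * g183cov n N μ ν k k' p * phaseNeg n k' b p)
      = ∑ k, ∑ k', phase163 n k a p * (g183cov m N μ ν (iotaK n m hnm k) (iotaK n m hnm k') p
          - g183cov n N μ ν k k' p) * phaseNeg n k' b p := by
    rw [← Finset.sum_sub_distrib]; refine Finset.sum_congr rfl (fun k _ => ?_)
    rw [← Finset.sum_sub_distrib]; exact Finset.sum_congr rfl (fun k' _ => by ring)
  -- the paired estimate
  have TP : ‖(∑ k : Fin d → Fin n, ∑ k' : Fin d → Fin n,
        phase163 n k a p * g183cov m N μ ν (iotaK n m hnm k) (iotaK n m hnm k') p * phaseNeg n k' b p)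
      - (∑ k, ∑ k', phase163 n k a p * g183cov n N μ ν k k' p * phaseNeg n k' b p)‖
      ≤ Real.exp κ ^ d * Real.exp κ ^ d * (κG d * ((n : ℝ))⁻¹ * Crw d * Crw d + CR d N / (n : ℝ) ^ 2) := by
    rw [hdiff]
    have inner : ∀ k : Fin d → Fin n,
        ∑ k', ‖phase163 n k a p * (g183cov m N μ ν (iotaK n m hnm k) (iotaK n m hnm k') p
            - g183cov n N μ ν k k' p) * phaseNeg n k' b p‖
          ≤ Real.exp κ ^ d * Real.exp κ ^ d * (κG d * ((n : ℝ))⁻¹ * Crw d) * rw n k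
            + Real.exp κ ^ d * Real.exp κ ^ d / (n : ℝ) ^ 2 * corrR n N k := by
      intro k
      have t : ∀ k', ‖phase163 n k a p * (g183cov m N μ ν (iotaK n m hnm k) (iotaK n m hnm k') p
            - g183cov n N μ ν k k' p) * phaseNeg n k' b p‖
          ≤ Real.exp κ ^ d * Real.exp κ ^ d * (κG d * ((n : ℝ))⁻¹ * rw n k) * rw n k'
            + Real.exp κ ^ d * Real.exp κ ^ d / (n : ℝ) ^ 2 * (if μ = ν ∧ k = k' then corrR n N k else 0) := by
        intro k'
        rw [norm_mul, norm_mul]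
        have h1 := norm_phase163_le n hp k a
        have h2 := norm_phaseNeg_le n hp k' b
        have h3 := (gcov_RB hn hnm hκ0 hκ hp N μ ν k k').sub
        have hI : 0 ≤ κG d * (((n : ℝ))⁻¹ * (rw n k * rw n k'))
            + (if μ = ν ∧ k = k' then corrR n N k else 0) / (n : ℝ) ^ 2 := by
          have : 0 ≤ (if μ = ν ∧ k = k' then corrR n N k else 0) := by
            split_ifs
            · exact corrR_nonneg n N k
            · exact le_rfl
          have := κG_nonneg d; have := rw_pos n k; have := rw_pos n k'
          positivity
        have := mul_le_mul (mul_le_mul h1 h3 (norm_nonneg _) hE0) h2 (norm_nonneg _) (mul_nonneg hE0 hI)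
        refine this.trans (le_of_eq ?_); ring
      refine (Finset.sum_le_sum (fun k' _ => t k')).trans ?_
      rw [Finset.sum_add_distrib, ← Finset.mul_sum, ← Finset.mul_sum]
      have s1 := sum_rw_le n (d := d)
      have s2 := sum_ite_and_eq_le (μ = ν) k (corrR_nonneg n N k)
      have hκG := κG_nonneg d; have hr := (rw_pos n k).le; have hC := Crw_nonneg d
      have c1 : 0 ≤ Real.exp κ ^ d * Real.exp κ ^ d * (κG d * ((n : ℝ))⁻¹ * rw n k) := by positivity
      have c2 : 0 ≤ Real.exp κ ^ d * Real.exp κ ^ d / (n : ℝ) ^ 2 := by positivity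
      exact (add_le_add (mul_le_mul_of_nonneg_left s1 c1) (mul_le_mul_of_nonneg_left s2 c2)).trans
        (le_of_eq (by ring))
    refine (norm_sum_le _ _).trans ((Finset.sum_le_sum (fun k _ => (norm_sum_le _ _).trans (inner k))).trans ?_)
    rw [Finset.sum_add_distrib, ← Finset.mul_sum, ← Finset.mul_sum]
    have s1 := sum_rw_le n (d := d)
    have s3 := sum_corrR_le n hN
    have hκG := κG_nonneg d; have hC := Crw_nonneg d
    have c1 : 0 ≤ Real.exp κ ^ d * Real.exp κ ^ d * (κG d * ((n : ℝ))⁻¹ * Crw d) := by positivity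
    have c2 : 0 ≤ Real.exp κ ^ d * Real.exp κ ^ d / (n : ℝ) ^ 2 := by positivity
    exact (add_le_add (mul_le_mul_of_nonneg_left s1 c1) (mul_le_mul_of_nonneg_left s3 c2)).trans
      (le_of_eq (by ring))
  -- the unpaired estimate
  have TU : ‖∑ K : Fin d → Fin m, ∑ K' : Fin d → Fin m,
        (if (∀ ν, Paired n m (K ν)) ∧ (∀ ν, Paired n m (K' ν)) then 0
          else phase163 m K a' p * g183cov m N μ ν K K' p * phaseNeg m K' b' p)‖
      ≤ Real.exp κ ^ d * Real.exp κ ^ d * (2 / n * (βG d * Crw d * Crw d + CU d N)) := by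
    have hβ := βG_nonneg d; have hC := Crw_nonneg d; have h2n : (0 : ℝ) ≤ 2 / n := by positivity
    have innerU : ∀ K : Fin d → Fin m,
        ∑ K', ‖(if (∀ ν, Paired n m (K ν)) ∧ (∀ ν, Paired n m (K' ν)) then 0
            else phase163 m K a' p * g183cov m N μ ν K K' p * phaseNeg m K' b' p)‖
          ≤ Real.exp κ ^ d * Real.exp κ ^ d * (2 / n) * (βG d * Crw d) * rw m K
            + Real.exp κ ^ d * Real.exp κ ^ d * (2 / n) * corrU m N K := by
      intro K
      have hr := (rw_pos m K).le; have hcU := corrU_nonneg m N K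
      have t : ∀ K', ‖(if (∀ ν, Paired n m (K ν)) ∧ (∀ ν, Paired n m (K' ν)) then 0
            else phase163 m K a' p * g183cov m N μ ν K K' p * phaseNeg m K' b' p)‖
          ≤ Real.exp κ ^ d * Real.exp κ ^ d * (2 / n) * (βG d * rw m K) * rw m K'
            + Real.exp κ ^ d * Real.exp κ ^ d * (2 / n) * (if K = K' then corrU m N K else 0) := by
        intro K'
        have hr' := (rw_pos m K').le
        have hi : 0 ≤ (if K = K' then corrU m N K else 0) := by split_ifs; exact hcU; exact le_rfl
        by_cases hc : (∀ ν, Paired n m (K ν)) ∧ ∀ ν, Paired n m (K' ν)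
        · rw [if_pos hc, norm_zero]; positivity
        · rw [if_neg hc]
          exact (unpaired_term_le hn hnm hκ0 hκ hp N μ ν a' b' K K' hc).trans (le_of_eq (by ring))
      refine (Finset.sum_le_sum (fun K' _ => t K')).trans ?_
      rw [Finset.sum_add_distrib, ← Finset.mul_sum, ← Finset.mul_sum, Finset.sum_ite_eq]
      simp only [Finset.mem_univ, if_true]
      have s1 := sum_rw_le m (d := d)
      have c1 : 0 ≤ Real.exp κ ^ d * Real.exp κ ^ d * (2 / n) * (βG d * rw m K) := by positivity
      exact (add_le_add (mul_le_mul_of_nonneg_left s1 c1) le_rfl).trans (le_of_eq (by ring))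
    refine (norm_sum_le _ _).trans ((Finset.sum_le_sum (fun K _ => (norm_sum_le _ _).trans (innerU K))).trans ?_)
    rw [Finset.sum_add_distrib, ← Finset.mul_sum, ← Finset.mul_sum]
    have s1 := sum_rw_le m (d := d)
    have s4 := sum_corrU_le m hN
    have c1 : 0 ≤ Real.exp κ ^ d * Real.exp κ ^ d * (2 / n) * (βG d * Crw d) := by positivity
    have c2 : 0 ≤ Real.exp κ ^ d * Real.exp κ ^ d * (2 / n) := by positivity
    exact (add_le_add (mul_le_mul_of_nonneg_left s1 c1) (mul_le_mul_of_nonneg_left s4 c2)).trans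
      (le_of_eq (by ring))
  -- assembly
  have key : ∀ (PP U Pn : ℂ) (tp tu : ℝ), ‖PP - Pn‖ ≤ tp → ‖U‖ ≤ tu → ‖PP + U - Pn‖ ≤ tp + tu := by
    intro PP U Pn tp tu h1 h2
    rw [add_sub_right_comm]; exact (norm_add_le _ _).trans (add_le_add h1 h2)
  rw [hMm, hMn]
  refine (key _ _ _ _ _ TP TU).trans ?_
  have hcr := div_sq_le_mul_inv (CR_nonneg d N) hn1
  have h1 : Real.exp κ ^ d * Real.exp κ ^ d * (κG d * ((n : ℝ))⁻¹ * Crw d * Crw d + CR d N / (n : ℝ) ^ 2)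
      ≤ Real.exp κ ^ d * Real.exp κ ^ d * (κG d * ((n : ℝ))⁻¹ * Crw d * Crw d + CR d N * ((n : ℝ))⁻¹) :=
    mul_le_mul_of_nonneg_left (add_le_add le_rfl hcr) (mul_nonneg hE0 hE0)
  refine (add_le_add h1 le_rfl).trans (le_of_eq ?_)
  unfold C183two; rw [div_eq_mul_inv (2 : ℝ) (n : ℝ)]; ring

end Rate

/-- **THE η-RATE OF THE CONTINUED COVARIANT REGULAR PART** (all `1 ≤ n ≤ m`; `p′ ∈ Strip κ`, `κ ≤ κ₁₈₃`,
`N ≥ d`; physical coarse points `a′·n = a·m`, `b′·n = b·m`):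
`‖Mcov_m(p′) − Mcov_n(p′)‖ ≤ e^{κd}e^{κd}·C183(d,N)/n` — ABSOLUTE rate `γ = 1` in `η = 1/n`, uniform on the
strip, explicit constant. [folklore] -/
theorem Mcov_rate {n m : ℕ} [NeZero n] [NeZero m] (hn : 1 ≤ n) (hnm : n ≤ m) {κ : ℝ} (hκ0 : 0 ≤ κ)
    (hκ : κ ≤ kappa183 d) {N : ℕ} (hN : d ≤ N) {p : Fin d → ℂ} (hp : p ∈ Strip d κ) (μ ν : Fin d)
    (a b : Fin d → Fin n) (a' b' : Fin d → Fin m) (ha : ∀ ν, (a' ν : ℕ) * n = (a ν : ℕ) * m)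
    (hb : ∀ ν, (b' ν : ℕ) * n = (b ν : ℕ) * m) :
    ‖Mcov m N μ ν a' b' p - Mcov n N μ ν a b p‖ ≤ Real.exp κ ^ d * Real.exp κ ^ d * C183 d N / n := by
  have hE0 : 0 ≤ Real.exp κ ^ d := by positivity
  rcases Nat.lt_or_ge n 2 with h2 | h2
  · have hn1 : (n : ℝ) = 1 := by exact_mod_cast (show n = 1 by omega)
    have hN' : d ≤ N + 1 := by omega
    have hm := norm_Mcov_le m hκ0 hκ hp hN' μ ν a' b'
    have hnn := norm_Mcov_le n hκ0 hκ hp hN' μ ν a b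
    have hC := C183two_nonneg d N
    rw [hn1, div_one]
    refine (norm_sub_le _ _).trans ?_
    unfold C183; nlinarith [mul_nonneg (mul_nonneg hE0 hE0) hC]
  · have h := Mcov_rate_two h2 hnm hκ0 hκ hp hN μ ν a b a' b' ha hb
    have hC := C183two_le_C183 d N
    have hn0 : (0 : ℝ) < n := by positivity
    refine h.trans (div_le_div_of_nonneg_right ?_ hn0.le)
    exact mul_le_mul_of_nonneg_left hC (mul_nonneg hE0 hE0)


/-! ## §5 Position space: strip regularity of the level difference and the kernel rates

Dimension `d + 1` (the b04 engine is stated on `ℂ^{d+1}`), width `0 ≤ κ ≤ κ₁₈₃(d+1)`, `N ≥ d + 1`. -/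

section Position

open Literature.MathematicalPhysics.QuantumFieldTheory.Balaban1983to89.B4ContourShift (StripRegular latticeKernel
  latticeKernel_decay supNorm)
open Literature.MathematicalPhysics.QuantumFieldTheory.Balaban1983to89.B4Green242Bridge (latticeKernel_sub)
open Literature.MathematicalPhysics.QuantumFieldTheory.Balaban1983to89.T4GaugeActionRateStrip (torusKernel_descendC_sub)
open Literature.MathematicalPhysics.QuantumFieldTheory.Balaban1983to89.B4TorusKernel (descendC periodConst)
open Literature.MathematicalPhysics.QuantumFieldTheory.Balaban1983to89.B4TorusKernel.MultiPeriod
  (torusKernel torusSupNorm torusKernel_descend_decay_torusMetric)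

/-- the explicit `d, N`-only position-space rate constant `(e¹)^d (e¹)^d · C183 d N`. [folklore] -/
def C183e (d N : ℕ) : ℝ := Real.exp 1 ^ d * Real.exp 1 ^ d * C183 d N

/-- `0 ≤ C183e`. [folklore] -/
theorem C183e_nonneg (d N : ℕ) : 0 ≤ C183e d N := by unfold C183e; have := C183_nonneg d N; positivity

variable {n m : ℕ} [NeZero n] [NeZero m]

/-- **STRIP REGULARITY OF THE LEVEL DIFFERENCE** `M^{cov,N}_{a′b′;μν}{}^{(m)} − M^{cov,N}_{ab;μν}{}^{(n)}` on
`Strip (d+1) κ`, `0 ≤ κ ≤ κ₁₈₃(d+1)`, `N ≥ d + 1`, with bound THE RATE `C183e(d+1,N)/n`. [folklore] -/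
theorem stripRegular_Mcov_sub (hn : 1 ≤ n) (hnm : n ≤ m) {κ : ℝ} (hκ0 : 0 ≤ κ) (hκ : κ ≤ kappa183 (d + 1))
    {N : ℕ} (hN : d + 1 ≤ N) (μ ν : Fin (d + 1)) (a b : Fin (d + 1) → Fin n) (a' b' : Fin (d + 1) → Fin m)
    (ha : ∀ ι, (a' ι : ℕ) * n = (a ι : ℕ) * m) (hb : ∀ ι, (b' ι : ℕ) * n = (b ι : ℕ) * m) :
    StripRegular (d := d) (fun p => Mcov m N μ ν a' b' p - Mcov n N μ ν a b p) κ (C183e (d + 1) N / n) := by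
  have hN' : d + 1 ≤ N + 1 := by omega
  have h₂ := stripRegular_Mcov (d := d) m hκ0 hκ hN' μ ν a' b'
  have h₁ := stripRegular_Mcov (d := d) n hκ0 hκ hN' μ ν a b
  have hκ1 : κ ≤ 1 := (hκ.trans (kappa183_le_rOf (d + 1))).trans ((rOf_le (d + 1)).trans (by norm_num))
  refine ⟨h₂.cont.sub h₁.cont, fun i q hq => (h₂.diff i q hq).sub (h₁.diff i q hq), ?_, ?_⟩
  · intro i q hq y hy
    show Mcov m N μ ν a' b' _ - Mcov n N μ ν a b _ = Mcov m N μ ν a' b' _ - Mcov n N μ ν a b _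
    rw [h₂.sides i q hq y hy, h₁.sides i q hq y hy]
  · intro p hp
    refine (Mcov_rate hn hnm hκ0 hκ hN hp μ ν a b a' b' ha hb).trans ?_
    unfold C183e
    have hC := C183_nonneg (d + 1) N
    have he : Real.exp κ ^ (d + 1) ≤ Real.exp 1 ^ (d + 1) :=
      pow_le_pow_left₀ (Real.exp_pos κ).le (Real.exp_le_exp.mpr hκ1) _
    have he0 : 0 ≤ Real.exp κ ^ (d + 1) := by positivity
    exact div_le_div_of_nonneg_right
      (mul_le_mul_of_nonneg_right (mul_le_mul he he he0 (by positivity)) hC) (Nat.cast_nonneg n)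

/-- **η-RATE OF THE INFINITE-LATTICE KERNELS** of `M^{cov,N}` (`B4ContourShift.latticeKernel_decay` BY NAME): for
`1 ≤ n ≤ m`, the same physical fine offsets, `N ≥ d + 1`, every `x ∈ ℤ^{d+1}`:
`‖K_{a′b′}^{(m)}(x) − K_{ab}^{(n)}(x)‖ ≤ C183e(d+1,N)/n · e^{−κ₁₈₃(d+1)|x|_∞}`. [folklore] -/
theorem latticeKernel_Mcov_rate (hn : 1 ≤ n) (hnm : n ≤ m) {N : ℕ} (hN : d + 1 ≤ N) (μ ν : Fin (d + 1))
    (a b : Fin (d + 1) → Fin n) (a' b' : Fin (d + 1) → Fin m) (ha : ∀ ι, (a' ι : ℕ) * n = (a ι : ℕ) * m)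
    (hb : ∀ ι, (b' ι : ℕ) * n = (b ι : ℕ) * m) (x : Fin (d + 1) → ℤ) :
    ‖latticeKernel (fun p : Fin (d + 1) → ℂ => Mcov m N μ ν a' b' p) x
        - latticeKernel (fun p : Fin (d + 1) → ℂ => Mcov n N μ ν a b p) x‖
      ≤ C183e (d + 1) N / n * Real.exp (-(kappa183 (d + 1) * supNorm x)) := by
  have hκ0 : 0 ≤ kappa183 (d + 1) := (kappa183_pos (d + 1)).le
  have hN' : d + 1 ≤ N + 1 := by omega
  have I₁ := (stripRegular_Mcov (d := d) n hκ0 le_rfl hN' μ ν a b).integrableOn hκ0 x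
  have I₂ := (stripRegular_Mcov (d := d) m hκ0 le_rfl hN' μ ν a' b').integrableOn hκ0 x
  rw [← latticeKernel_sub x I₂ I₁]
  exact latticeKernel_decay (stripRegular_Mcov_sub hn hnm hκ0 le_rfl hN μ ν a b a' b' ha hb) hκ0 x

/-- **η-RATE OF THE TORUS KERNELS** of `M^{cov,N}` (`B4TorusKernel.MultiPeriod.torusKernel_descend_decay_torusMetric`
BY NAME), UNIFORMLY IN THE VOLUME: every period vector `P` (all `P_i ≥ 1`), `1 ≤ n ≤ m`, same physical fine
offsets, `N ≥ d + 1`, every `x`: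
`‖K_{a′b′,P}^{(m)}(x) − K_{ab,P}^{(n)}(x)‖ ≤ C183e(d+1,N)/n · periodConst(κ₁₈₃(d+1), d) · e^{−(κ₁₈₃(d+1)/(d+1))·|x|_{T,∞}}`.
[folklore] -/
theorem torusKernel_Mcov_rate (hn : 1 ≤ n) (hnm : n ≤ m) {N : ℕ} (hN : d + 1 ≤ N) (μ ν : Fin (d + 1))
    (a b : Fin (d + 1) → Fin n) (a' b' : Fin (d + 1) → Fin m) (ha : ∀ ι, (a' ι : ℕ) * n = (a ι : ℕ) * m)
    (hb : ∀ ι, (b' ι : ℕ) * n = (b ι : ℕ) * m) {P : Fin (d + 1) → ℕ} (hP : ∀ i, 1 ≤ P i)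
    (x : Fin (d + 1) → ℤ) :
    ‖torusKernel (descendC (fun p : Fin (d + 1) → ℂ => Mcov m N μ ν a' b' p)
          (stripRegular_Mcov m (kappa183_pos _).le le_rfl (Nat.le_succ_of_le hN) μ ν a' b') (kappa183_pos _).le) P x
        - torusKernel (descendC (fun p : Fin (d + 1) → ℂ => Mcov n N μ ν a b p)
          (stripRegular_Mcov n (kappa183_pos _).le le_rfl (Nat.le_succ_of_le hN) μ ν a b) (kappa183_pos _).le) P x‖ ≤
      C183e (d + 1) N / n * periodConst (kappa183 (d + 1)) d *
        Real.exp (-(kappa183 (d + 1) / (d + 1) * torusSupNorm P x)) := by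
  have hκ0 : 0 < kappa183 (d + 1) := kappa183_pos (d + 1)
  rw [torusKernel_descendC_sub (stripRegular_Mcov n hκ0.le le_rfl (Nat.le_succ_of_le hN) μ ν a b)
    (stripRegular_Mcov m hκ0.le le_rfl (Nat.le_succ_of_le hN) μ ν a' b')
    (stripRegular_Mcov_sub hn hnm hκ0.le le_rfl hN μ ν a b a' b' ha hb) hκ0.le P x]
  exact torusKernel_descend_decay_torusMetric _ hκ0 hP x

/-- KING'S SHAPE `n = L^k`, `m = L^{k+j}` (fine offsets `a, b` and `a′ = a·L^j`, `b′ = b·L^j` componentwise):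
amplitude `C183e(d+1,N)·L^{−k}` on `ℤ^{d+1}`. [folklore] -/
theorem latticeKernel_Mcov_rate_king (L k j : ℕ) [NeZero L] {N : ℕ} (hN : d + 1 ≤ N) (μ ν : Fin (d + 1))
    (a b : Fin (d + 1) → Fin (L ^ k)) (a' b' : Fin (d + 1) → Fin (L ^ (k + j)))
    (ha : ∀ ι, (a' ι : ℕ) * L ^ k = (a ι : ℕ) * L ^ (k + j)) (hb : ∀ ι, (b' ι : ℕ) * L ^ k = (b ι : ℕ) * L ^ (k + j))
    (x : Fin (d + 1) → ℤ) :
    ‖latticeKernel (fun p : Fin (d + 1) → ℂ => Mcov (L ^ (k + j)) N μ ν a' b' p) x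
        - latticeKernel (fun p : Fin (d + 1) → ℂ => Mcov (L ^ k) N μ ν a b p) x‖
      ≤ C183e (d + 1) N / (L : ℝ) ^ k * Real.exp (-(kappa183 (d + 1) * supNorm x)) := by
  have hL : 1 ≤ L := Nat.one_le_iff_ne_zero.mpr (NeZero.ne L)
  have h := latticeKernel_Mcov_rate (d := d) (n := L ^ k) (m := L ^ (k + j)) (Nat.one_le_pow _ _ hL)
    (Nat.pow_le_pow_right hL (by omega)) hN μ ν a b a' b' ha hb x
  simpa using h

/-- KING'S SHAPE on every torus. [folklore] -/
theorem torusKernel_Mcov_rate_king (L k j : ℕ) [NeZero L] {N : ℕ} (hN : d + 1 ≤ N) (μ ν : Fin (d + 1))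
    (a b : Fin (d + 1) → Fin (L ^ k)) (a' b' : Fin (d + 1) → Fin (L ^ (k + j)))
    (ha : ∀ ι, (a' ι : ℕ) * L ^ k = (a ι : ℕ) * L ^ (k + j)) (hb : ∀ ι, (b' ι : ℕ) * L ^ k = (b ι : ℕ) * L ^ (k + j))
    {P : Fin (d + 1) → ℕ} (hP : ∀ i, 1 ≤ P i) (x : Fin (d + 1) → ℤ) :
    ‖torusKernel (descendC (fun p : Fin (d + 1) → ℂ => Mcov (L ^ (k + j)) N μ ν a' b' p)
          (stripRegular_Mcov (L ^ (k + j)) (kappa183_pos _).le le_rfl (Nat.le_succ_of_le hN) μ ν a' b')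
          (kappa183_pos _).le) P x
        - torusKernel (descendC (fun p : Fin (d + 1) → ℂ => Mcov (L ^ k) N μ ν a b p)
          (stripRegular_Mcov (L ^ k) (kappa183_pos _).le le_rfl (Nat.le_succ_of_le hN) μ ν a b)
          (kappa183_pos _).le) P x‖ ≤
      C183e (d + 1) N / (L : ℝ) ^ k * periodConst (kappa183 (d + 1)) d *
        Real.exp (-(kappa183 (d + 1) / (d + 1) * torusSupNorm P x)) := by
  have hL : 1 ≤ L := Nat.one_le_iff_ne_zero.mpr (NeZero.ne L)
  have h := torusKernel_Mcov_rate (d := d) (n := L ^ k) (m := L ^ (k + j)) (Nat.one_le_pow _ _ hL)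
    (Nat.pow_le_pow_right hL (by omega)) hN μ ν a b a' b' ha hb hP x
  simpa using h

end Position

end

end Literature.MathematicalPhysics.QuantumFieldTheory.Balaban1983to89.T4G183StripRate
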